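import Mathlib.Data.Finset.Sum
import Mathlib.Algebra.BigOperators.Fin
import Literature.ModelTheory.FiniteModelTheory.LinearSystemClosure
import Literature.ModelTheory.FiniteModelTheory.RationalSections
import HarnessLib

/-!
# Sparse OR-instances of two expanding linear systems fool cohomological `k`-consistency

Topic `Literature/ModelTheory/FiniteModelTheory`; the core of the discharge of
`LichterPago2025_cohomologyFooled` (`CohomologicalConsistencyLimits.lean`).

Lichter–Pago (arXiv:2407.09097, Thm 5.9) claim that the intractable OR-construction
`OR_⊥(𝔸₁,𝔸₂)` (`OrTemplate`, `OrConstruction.lean`) of the templates of ternary linear equations over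
`𝔽₂` and `𝔽₃` is not solved by Ó Conghaile's cohomological `k`-consistency algorithm
(`CohomologicallyKConsistent`, `CohomologicalConsistency.lean`) for any sublinear `k`.  Their fooling
instances `𝔹(𝔹₁,𝔹₂)` — OR-glued Tseitin systems with the COMPLETE bipartite link relation `B₁ × B₂` —
are in fact rejected (`LichterPago.orInstance_rejected`, `OrConstructionObstruction.lean`): fixing a
section with an escape value `c₂` forces, through the complete link relation, all of `B₁` to be honest,
and integral affine averaging then solves `𝔹₁`.  This file REPAIRS the construction (the proof is ours;
the statement it serves is the printed Theorem 5.9):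

* the link relation is a SPARSE bipartite graph `G` of bounded degree (so an escape constrains only
  boundedly many variables of the other side), and
* the two systems are arbitrary ternary systems `∑_{v ∈ S u} x_v = b u` on a boundary expander
  (three variables per equation), for which `LinearSystemClosure.lean` provides consistent CONDITIONED
  local distributions with `p`-power denominators.

Main result `SparseOr.cohomologicallyKConsistent`: if every set `T` of at most `r` equations has
`|T| ≤ 2|∂T|`, `G` has in- and out-degrees `≤ d`, and `4(d+2)k ≤ r`, then the sparse OR-instance is
cohomologically `k`-consistent w.r.t. `OR_⊥(𝔽₂-equations, 𝔽₃-equations)`.  The self-supporting family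
(Observation 22 form, `cohomologicallyKConsistent_iff_zext`) consists of the sort-respecting LAZY
partial homomorphisms (every equation inside the context is satisfied or touches an escape `c_i`; no
`G`-edge carries `(c₁,c₂)`) whose honest parts are GOOD (`LinSystem.Good`) for the respective system.
`ℤ`-extendability of a member `σ₀`: a `2`-adic rational linear section (sort 1: the local distribution
of the `𝔽₂`-system conditioned on the honest part of `σ₀`, escapes kept; sort 2: the point mass at ONE
global lazy assignment — `σ₀` on its context, a good honest extension on the `G`-neighbours of the
escapes of `σ₀`, `c₂` elsewhere) and the symmetric `3`-adic one are combined by Bezout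
(`SectionSystem.ZExt.of_isRatSection_coprime`, `RationalSections.lean`).

Unsatisfiability of such instances (`SparseOr.isEmpty_hom`, from robust unsatisfiability of the two
systems and a mixing property of `G`) is the last section of this file; the existence of the
combinatorial data is `SparseOrData.lean`.

## References

* [LichterPago2025] M. Lichter, B. Pago, *Limitations of affine integer relaxations for solving
  constraint satisfaction problems*, arXiv:2407.09097, §3.2 (OR_⊥), Lemma 2.2, §4 (robustly consistent
  assignments, Cor. 4.13), Thm 5.9.
* [OConghaile2022] A. Ó Conghaile, *Cohomology in constraint satisfaction and structure isomorphism*,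
  MFCS 2022 = arXiv:2206.15253, Def. 5, Observation 22.
-/

namespace Literature.ModelTheory.FiniteModelTheory

open Finset FirstOrder FirstOrder.Language FirstOrder.Language.Structure

/-! ### Ternary linear equations over `ℤ/p`: vocabulary, template, instances -/

/-- The relation symbols of the vocabulary of TERNARY LINEAR EQUATIONS over `ℤ/p`: one ternary symbol
`R_c` for every right-hand side `c`. [cite: LichterPago2025, §2 (Γ-coset CSPs, Tseitin systems)] -/
inductive LinRel (p : ℕ) : ℕ → Type
  | eq (c : ZMod p) : LinRel p 3

/-- The vocabulary of ternary linear equations over `ℤ/p` (relational). [cite: LichterPago2025, §2] -/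
def linLanguage (p : ℕ) : Language := ⟨fun _ => Empty, LinRel p⟩

/-- The vocabulary is relational. [folklore] -/
instance (p : ℕ) : (linLanguage p).IsRelational := fun _ => Empty.instIsEmpty

/-- There are no `0`-ary symbols. [folklore] -/
instance (p : ℕ) : IsEmpty ((linLanguage p).Relations 0) := ⟨fun r => nomatch r⟩

/-- THE TEMPLATE of ternary linear equations over `ℤ/p`: universe `ZMod p`,
`R_c = {(x,y,z) : x + y + z = c}`. [cite: LichterPago2025, §2] -/
instance linTemplateStructure (p : ℕ) : (linLanguage p).Structure (ZMod p) where
  RelMap := fun {n} r x =>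
    match n, r, x with
    | _, LinRel.eq c, x => x 0 + x 1 + x 2 = c

/-- Unfolding the template relation. [folklore] -/
theorem linTemplate_relMap {p : ℕ} (c : ZMod p) (x : Fin 3 → ZMod p) :
    RelMap (L := linLanguage p) (LinRel.eq c) x ↔ x 0 + x 1 + x 2 = c :=
  Iff.rfl

variable {U V : Type*}

/-- Interpretation of `R_c` in the INSTANCE of a system `(S, b)`: the injective enumerations of the scopes
`S u` with `b u = c`. [cite: LichterPago2025, §2 (the instance of a linear system)] -/
def LinHolds {p : ℕ} (S : U → Finset V) (b : U → ZMod p) : {n : ℕ} → LinRel p n → (Fin n → V) → Prop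
  | _, LinRel.eq c, y => ∃ u, b u = c ∧ Function.Injective y ∧ ∀ i, y i ∈ S u

/-- Unfolding `LinHolds`. [folklore] -/
theorem linHolds_eq {p : ℕ} (S : U → Finset V) (b : U → ZMod p) (c : ZMod p) (y : Fin 3 → V) :
    LinHolds S b (LinRel.eq c) y ↔ ∃ u, b u = c ∧ Function.Injective y ∧ ∀ i, y i ∈ S u :=
  Iff.rfl

/-! ### The sparse OR-instance -/

/-- The vocabulary `σ₁ ⊎ σ₂ ⊎ {S}` of the OR-construction of `𝔽₂`- and `𝔽₃`-equations. [cite: LichterPago2025, §3] -/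
abbrev orLinLanguage : Language := orLanguage (linLanguage 2) (linLanguage 3)

/-- The template `OR_⊥(𝔽₂-equations, 𝔽₃-equations)` (universe `𝔽₂ ⊎ 𝔽₃ ⊎ {c₁, c₂}`, 7 elements).
[cite: LichterPago2025, §3.2 and Thm 5.9] -/
abbrev OrLinTemplate : Type := OrTemplate (ZMod 2) (ZMod 3)

/-- The template is finite. [folklore] -/
noncomputable instance : Fintype OrLinTemplate :=
  inferInstanceAs (Fintype (Option (ZMod 2) ⊕ Option (ZMod 3)))

/-- Equality in the template is decidable. [folklore] -/
noncomputable instance : DecidableEq OrLinTemplate :=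
  inferInstanceAs (DecidableEq (Option (ZMod 2) ⊕ Option (ZMod 3)))

/-- **The sparse OR-instance** `𝔹_G(S; b₂, b₃)` on the universe `V ⊎ V`: sort 1 carries the instance of
the `𝔽₂`-system `(S, b₂)`, sort 2 that of the `𝔽₃`-system `(S, b₃)` (same scopes), and the link
relation is the bipartite graph `G` from sort 1 to sort 2 (Lichter–Pago take `G = V × V`).
[cite: LichterPago2025, §3 (𝔹(𝔹₁,𝔹₂)); this sparse variant: folklore] -/
@[reducible] def sparseOrStructure (S : U → Finset V) (b₂ : U → ZMod 2) (b₃ : U → ZMod 3) (G : V → V → Prop) :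
    orLinLanguage.Structure (V ⊕ V) where
  RelMap := fun {n} r x =>
    match n, r, x with
    | n, OrRel.inl r, x => ∃ y : Fin n → V, (∀ i, x i = Sum.inl (y i)) ∧ LinHolds S b₂ r y
    | n, OrRel.inr r, x => ∃ y : Fin n → V, (∀ i, x i = Sum.inr (y i)) ∧ LinHolds S b₃ r y
    | _, OrRel.link, x => ∃ v w, G v w ∧ x 0 = Sum.inl v ∧ x 1 = Sum.inr w

namespace SparseOr

variable (S : U → Finset V) (b₂ : U → ZMod 2) (b₃ : U → ZMod 3) (G : V → V → Prop)

/-- Unfolding a sort-1 relation of the sparse OR-instance. [folklore] -/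
theorem relMap_inl {n : ℕ} (r : LinRel 2 n) (x : Fin n → V ⊕ V) :
    @RelMap orLinLanguage (V ⊕ V) (sparseOrStructure S b₂ b₃ G) n (OrRel.inl r) x ↔
      ∃ y : Fin n → V, (∀ i, x i = Sum.inl (y i)) ∧ LinHolds S b₂ r y :=
  Iff.rfl

/-- Unfolding a sort-2 relation of the sparse OR-instance. [folklore] -/
theorem relMap_inr {n : ℕ} (r : LinRel 3 n) (x : Fin n → V ⊕ V) :
    @RelMap orLinLanguage (V ⊕ V) (sparseOrStructure S b₂ b₃ G) n (OrRel.inr r) x ↔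
      ∃ y : Fin n → V, (∀ i, x i = Sum.inr (y i)) ∧ LinHolds S b₃ r y :=
  Iff.rfl

/-- Unfolding the link relation of the sparse OR-instance. [folklore] -/
theorem relMap_link (x : Fin 2 → V ⊕ V) :
    @RelMap orLinLanguage (V ⊕ V) (sparseOrStructure S b₂ b₃ G) 2 OrRel.link x ↔
      ∃ v w, G v w ∧ x 0 = Sum.inl v ∧ x 1 = Sum.inr w :=
  Iff.rfl

/-! ### Values in the template -/

/-- The honest `𝔽₂`-value of a template element (`0` on escapes and on sort 2). [folklore] -/
def hv₁ : OrLinTemplate → ZMod 2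
  | Sum.inl (some z) => z
  | _ => 0

/-- The honest `𝔽₃`-value of a template element (`0` on escapes and on sort 1). [folklore] -/
def hv₂ : OrLinTemplate → ZMod 3
  | Sum.inr (some z) => z
  | _ => 0

/-- The honest `𝔽₂`-value of an honest sort-1 element. [folklore] -/
@[simp] theorem hv₁_inl_some (z : ZMod 2) : hv₁ (Sum.inl (some z)) = z := rfl

/-- The honest `𝔽₃`-value of an honest sort-2 element. [folklore] -/
@[simp] theorem hv₂_inr_some (z : ZMod 3) : hv₂ (Sum.inr (some z)) = z := rfl

/-- The total extension of a section (default value `c₁` outside its context). [folklore] -/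
noncomputable def tot [DecidableEq V] {X : Finset (V ⊕ V)} (σ : ↥X → OrLinTemplate) :
    V ⊕ V → OrLinTemplate :=
  fun x => if h : x ∈ X then σ ⟨x, h⟩ else Sum.inl none

variable {S b₂ b₃ G}
variable [DecidableEq V]

/-- `tot` on the context. [folklore] -/
theorem tot_of_mem {X : Finset (V ⊕ V)} (σ : ↥X → OrLinTemplate) {x : V ⊕ V} (h : x ∈ X) :
    tot σ x = σ ⟨x, h⟩ := by
  unfold tot; rw [dif_pos h]

/-- `tot` at a point of the context. [folklore] -/
theorem tot_coe {X : Finset (V ⊕ V)} (σ : ↥X → OrLinTemplate) (x : ↥X) : tot σ x = σ x := by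
  rw [tot_of_mem σ x.2]

/-- `tot` commutes with restriction on the smaller context. [folklore] -/
theorem tot_restrict {X' X : Finset (V ⊕ V)} (hX : X' ⊆ X) (σ : ↥X → OrLinTemplate) {x : V ⊕ V}
    (h : x ∈ X') : tot (SectionSystem.restrict hX σ) x = tot σ x := by
  rw [tot_of_mem _ h, tot_of_mem _ (hX h)]
  rfl

/-- Two sections over the same context with the same total extension are equal. [folklore] -/
theorem eq_of_tot_eq {X : Finset (V ⊕ V)} {σ τ : ↥X → OrLinTemplate} (h : ∀ x ∈ X, tot σ x = tot τ x) :
    σ = τ := by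
  funext x
  have := h x x.2
  rwa [tot_coe, tot_coe] at this

/-! ### The self-supporting family -/

variable (S b₂ b₃ G)
variable [Fintype U] [DecidableEq U] (r k : ℕ)

/-- **The family `𝓕`.**  A section `σ` over the context `X ⊆ V ⊎ V` (with `|X| ≤ k`) belongs to `𝓕(X)`
iff it is SORT-RESPECTING, LAZILY HOMOMORPHIC (every equation whose scope lies in the context is
satisfied by the honest values or touches an escape `c_i`; no `G`-edge inside the context carries
`(c₁, c₂)`), and its two HONEST PARTS ARE GOOD (`LinSystem.Good`) for the respective systems at
radius `r`. [cite: LichterPago2025, Lemma 3.6 and proof of Thm 5.9 (the family H(X)); OConghaile2022, Observation 22] -/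
def fam (X : Finset (V ⊕ V)) : Set (↥X → OrLinTemplate) :=
  {σ | X.card ≤ k ∧
    (∀ v, Sum.inl v ∈ X → ∃ o, tot σ (Sum.inl v) = Sum.inl o) ∧
    (∀ w, Sum.inr w ∈ X → ∃ o, tot σ (Sum.inr w) = Sum.inr o) ∧
    (∀ u, (∀ v ∈ S u, Sum.inl v ∈ X) →
      (∃ v ∈ S u, tot σ (Sum.inl v) = Sum.inl none) ∨
        ((∀ v ∈ S u, ∃ z, tot σ (Sum.inl v) = Sum.inl (some z)) ∧
          ∑ v ∈ S u, hv₁ (tot σ (Sum.inl v)) = b₂ u)) ∧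
    (∀ u, (∀ w ∈ S u, Sum.inr w ∈ X) →
      (∃ w ∈ S u, tot σ (Sum.inr w) = Sum.inr none) ∨
        ((∀ w ∈ S u, ∃ z, tot σ (Sum.inr w) = Sum.inr (some z)) ∧
          ∑ w ∈ S u, hv₂ (tot σ (Sum.inr w)) = b₃ u)) ∧
    (∀ v w, G v w → Sum.inl v ∈ X → Sum.inr w ∈ X → tot σ (Sum.inl v) = Sum.inl none →
      tot σ (Sum.inr w) ≠ Sum.inr none) ∧
    LinSystem.Good S b₂ r (X.toLeft.filter fun v => ∃ z, tot σ (Sum.inl v) = Sum.inl (some z))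
      (fun v => hv₁ (tot σ (Sum.inl v))) ∧
    LinSystem.Good S b₃ r (X.toRight.filter fun w => ∃ z, tot σ (Sum.inr w) = Sum.inr (some z))
      (fun w => hv₂ (tot σ (Sum.inr w)))}

variable {S b₂ b₃ G r k}

/-- A sum over a three-element scope along an injective enumeration. [folklore] -/
theorem sum_scope_eq_of_injective {M : Type*} [AddCommMonoid M] {T : Finset V} (hT : T.card = 3)
    {y : Fin 3 → V} (hy : Function.Injective y) (hyT : ∀ i, y i ∈ T) (f : V → M) :
    ∑ v ∈ T, f v = f (y 0) + f (y 1) + f (y 2) := by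
  classical
  have himg : Finset.univ.image y = T := by
    refine Finset.eq_of_subset_of_card_le (fun v hv => ?_) ?_
    · obtain ⟨i, -, rfl⟩ := Finset.mem_image.1 hv
      exact hyT i
    · rw [hT, Finset.card_image_of_injective _ hy, Finset.card_univ, Fintype.card_fin]
  rw [← himg, Finset.sum_image fun i _ j _ h => hy h, Fin.sum_univ_three]

/-- A member of an injectively enumerated three-element scope is enumerated. [folklore] -/
theorem exists_eq_of_mem_scope {T : Finset V} (hT : T.card = 3) {y : Fin 3 → V}
    (hy : Function.Injective y) (hyT : ∀ i, y i ∈ T) {v : V} (hv : v ∈ T) : ∃ i, y i = v := by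
  classical
  have himg : Finset.univ.image y = T := by
    refine Finset.eq_of_subset_of_card_le (fun v hv => ?_) ?_
    · obtain ⟨i, -, rfl⟩ := Finset.mem_image.1 hv
      exact hyT i
    · rw [hT, Finset.card_image_of_injective _ hy, Finset.card_univ, Fintype.card_fin]
  rw [← himg] at hv
  obtain ⟨i, -, hi⟩ := Finset.mem_image.1 hv
  exact ⟨i, hi⟩

/-- **`𝓕 ⊆ 𝓗_k`**: every member of the family is a `k`-local partial homomorphism from the sparse
OR-instance to `OR_⊥`. [cite: LichterPago2025, Lemmas 3.3–3.4 and 3.16] -/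
theorem fam_le_homSystem (hS3 : ∀ u, (S u).card = 3) :
    fam S b₂ b₃ G r k ≤ @homSystem orLinLanguage k (V ⊕ V) OrLinTemplate
      (sparseOrStructure S b₂ b₃ G) _ := by
  intro X σ hσ
  obtain ⟨hk, hs₁, hs₂, hl₁, hl₂, hlink, -, -⟩ := hσ
  refine ⟨hk, ?_⟩
  intro n R x hx
  match n, R, x, hx with
  | n, OrRel.inl R, x, hx =>
    obtain ⟨y, hy, hR⟩ := (relMap_inl S b₂ b₃ G R _).1 hx
    match n, R, x, y, hy, hR with
    | _, LinRel.eq c, x, y, hy, hR =>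
      obtain ⟨u, rfl, hyinj, hyS⟩ := hR
      have hmem : ∀ i, Sum.inl (y i) ∈ X := fun i => hy i ▸ (x i).2
      have hval : ∀ i, σ (x i) = tot σ (Sum.inl (y i)) := fun i => by
        rw [tot_of_mem σ (hmem i)]; congr 1; exact Subtype.ext (hy i)
      have hscope : ∀ v ∈ S u, Sum.inl v ∈ X := fun v hv => by
        obtain ⟨i, rfl⟩ := exists_eq_of_mem_scope (hS3 u) hyinj hyS hv
        exact hmem i
      choose o ho using fun i => hs₁ (y i) (hmem i)
      refine (OrTemplate.relMap_inl (L₁ := linLanguage 2) (L₂ := linLanguage 3) (A₁ := ZMod 2)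
        (A₂ := ZMod 3) (show (linLanguage 2).Relations 3 from LinRel.eq (b₂ u)) _).2 ⟨o, fun i => ?_, ?_⟩
      · show σ (x i) = _
        rw [hval i, ho i]; rfl
      rcases hl₁ u hscope with ⟨v, hv, hesc⟩ | ⟨hhon, hsum⟩
      · obtain ⟨i, rfl⟩ := exists_eq_of_mem_scope (hS3 u) hyinj hyS hv
        refine Or.inr (Or.inl ⟨i, ?_⟩)
        have := (ho i).symm.trans hesc
        exact Sum.inl_injective this
      · choose z hz using fun i => hhon (y i) (hyS i)
        refine Or.inr (Or.inr ⟨z, fun i => Sum.inl_injective ((ho i).symm.trans (hz i)), ?_⟩)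
        show z 0 + z 1 + z 2 = b₂ u
        rw [sum_scope_eq_of_injective (hS3 u) hyinj hyS] at hsum
        simpa only [hz, hv₁_inl_some] using hsum
  | n, OrRel.inr R, x, hx =>
    obtain ⟨y, hy, hR⟩ := (relMap_inr S b₂ b₃ G R _).1 hx
    match n, R, x, y, hy, hR with
    | _, LinRel.eq c, x, y, hy, hR =>
      obtain ⟨u, rfl, hyinj, hyS⟩ := hR
      have hmem : ∀ i, Sum.inr (y i) ∈ X := fun i => hy i ▸ (x i).2
      have hval : ∀ i, σ (x i) = tot σ (Sum.inr (y i)) := fun i => by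
        rw [tot_of_mem σ (hmem i)]; congr 1; exact Subtype.ext (hy i)
      have hscope : ∀ w ∈ S u, Sum.inr w ∈ X := fun w hw => by
        obtain ⟨i, rfl⟩ := exists_eq_of_mem_scope (hS3 u) hyinj hyS hw
        exact hmem i
      choose o ho using fun i => hs₂ (y i) (hmem i)
      refine (OrTemplate.relMap_inr (L₁ := linLanguage 2) (L₂ := linLanguage 3) (A₁ := ZMod 2)
        (A₂ := ZMod 3) (show (linLanguage 3).Relations 3 from LinRel.eq (b₃ u)) _).2 ⟨o, fun i => ?_, ?_⟩
      · show σ (x i) = _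
        rw [hval i, ho i]; rfl
      rcases hl₂ u hscope with ⟨w, hw, hesc⟩ | ⟨hhon, hsum⟩
      · obtain ⟨i, rfl⟩ := exists_eq_of_mem_scope (hS3 u) hyinj hyS hw
        refine Or.inr (Or.inl ⟨i, ?_⟩)
        have := (ho i).symm.trans hesc
        exact Sum.inr_injective this
      · choose z hz using fun i => hhon (y i) (hyS i)
        refine Or.inr (Or.inr ⟨z, fun i => Sum.inr_injective ((ho i).symm.trans (hz i)), ?_⟩)
        show z 0 + z 1 + z 2 = b₃ u
        rw [sum_scope_eq_of_injective (hS3 u) hyinj hyS] at hsum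
        simpa only [hz, hv₂_inr_some] using hsum
  | _, OrRel.link, x, hx =>
    obtain ⟨v, w, hvw, h0, h1⟩ := (relMap_link S b₂ b₃ G _).1 hx
    have hmv : Sum.inl v ∈ X := h0 ▸ (x 0).2
    have hmw : Sum.inr w ∈ X := h1 ▸ (x 1).2
    have e0 : σ (x 0) = tot σ (Sum.inl v) := by
      rw [tot_of_mem σ hmv]; congr 1; exact Subtype.ext h0
    have e1 : σ (x 1) = tot σ (Sum.inr w) := by
      rw [tot_of_mem σ hmw]; congr 1; exact Subtype.ext h1
    obtain ⟨o₁, ho₁⟩ := hs₁ v hmv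
    obtain ⟨o₂, ho₂⟩ := hs₂ w hmw
    refine (OrTemplate.relMap_link (L₁ := linLanguage 2) (L₂ := linLanguage 3) _).2 ?_
    cases o₁ with
    | some a =>
      exact Or.inl ⟨a, o₂, by show σ (x 0) = _; rw [e0, ho₁]; rfl,
        by show σ (x 1) = _; rw [e1, ho₂]; rfl⟩
    | none =>
      cases o₂ with
      | some a =>
        exact Or.inr ⟨none, a, by show σ (x 0) = _; rw [e0, ho₁]; rfl,
          by show σ (x 1) = _; rw [e1, ho₂]; rfl⟩
      | none => exact absurd ho₂ (hlink v w hvw hmv hmw ho₁)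

/-- The empty section belongs to the family (on an expander: its honest parts are good).
[cite: OConghaile2022, Def. 5 (non-emptiness)] -/
theorem empty_mem_fam (hS3 : ∀ u, (S u).card = 3)
    (hexp : ∀ T : Finset U, T.card ≤ r → 1 * T.card ≤ 2 * (XorSystem.boundary S T).card)
    (σ : ↥(∅ : Finset (V ⊕ V)) → OrLinTemplate) : σ ∈ fam S b₂ b₃ G r k (∅ : Finset (V ⊕ V)) := by
  have hne : ∀ u, ∃ v, v ∈ S u := fun u =>
    Finset.card_pos.1 (by rw [hS3]; exact Nat.succ_pos 2)
  refine ⟨by simp, fun v hv => absurd hv (Finset.notMem_empty _),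
    fun w hw => absurd hw (Finset.notMem_empty _), fun u hu => ?_, fun u hu => ?_,
    fun v w _ hv => absurd hv (Finset.notMem_empty _), ?_, ?_⟩
  · obtain ⟨v, hv⟩ := hne u
    exact absurd (hu v hv) (Finset.notMem_empty _)
  · obtain ⟨w, hw⟩ := hne u
    exact absurd (hu w hw) (Finset.notMem_empty _)
  · have : (∅ : Finset (V ⊕ V)).toLeft.filter (fun v => ∃ z, tot σ (Sum.inl v) = Sum.inl (some z)) = ∅ := by
      simp
    rw [this]
    exact LinSystem.good_of_empty Nat.one_pos hexp _
  · have : (∅ : Finset (V ⊕ V)).toRight.filter (fun w => ∃ z, tot σ (Sum.inr w) = Sum.inr (some z)) = ∅ := by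
      simp
    rw [this]
    exact LinSystem.good_of_empty Nat.one_pos hexp _

/-! ### The `2`-adic rational linear section above a member of the family

Fix a base section `σ₀ ∈ 𝓕(X₀)`.  Sort 1 is distributed according to the local distribution of the
`𝔽₂`-system conditioned on the honest part `h₁` of `σ₀` (escapes of `σ₀` kept), sort 2 is frozen to
one global lazy assignment `g₂`. -/

/-! ### The `2`-adic rational linear section above a member of the family

Fix a base section `σ₀ ∈ 𝓕(X₀)`.  Sort 1 is distributed according to the local distribution of the
`𝔽₂`-system conditioned on the honest part `h₁` of `σ₀` (escapes of `σ₀` kept), sort 2 is frozen to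
one global lazy assignment `g₂`. -/

section TwoAdic

variable (X₀ : Finset (V ⊕ V)) (σ₀ : ↥X₀ → OrLinTemplate)

/-- The sort-1 escapes of the base section. [folklore] -/
noncomputable def Z₁ : Finset V := X₀.toLeft.filter fun v => tot σ₀ (Sum.inl v) = Sum.inl none

/-- The sort-2 escapes of the base section. [folklore] -/
noncomputable def Z₂ : Finset V := X₀.toRight.filter fun w => tot σ₀ (Sum.inr w) = Sum.inr none

/-- The honest sort-1 part `D X = X₁ ∖ Z₁` of a context `X` (for the base context this is the honest
domain `W₁` of `σ₀`). [folklore] -/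
noncomputable def D (X : Finset (V ⊕ V)) : Finset V := X.toLeft \ Z₁ X₀ σ₀

/-- The honest sort-2 domain of the base section. [folklore] -/
noncomputable def W₂ : Finset V := X₀.toRight \ Z₂ X₀ σ₀

/-- The honest sort-1 values of the base section (junk `0` elsewhere). [folklore] -/
noncomputable def h₁ : V → ZMod 2 := fun v => hv₁ (tot σ₀ (Sum.inl v))

/-- The honest sort-2 values of the base section (junk `0` elsewhere). [folklore] -/
noncomputable def h₂ : V → ZMod 3 := fun w => hv₂ (tot σ₀ (Sum.inr w))

/-- The honest sort-1 part of a section over `X`, as a section of the `𝔽₂`-system over `D X`. [folklore] -/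
noncomputable def hon (X : Finset (V ⊕ V)) (σ : ↥X → OrLinTemplate) : ↥(D X₀ σ₀ X) → ZMod 2 :=
  fun d => hv₁ (tot σ (Sum.inl (d : V)))

variable {X₀ σ₀}

/-! #### Elementary facts about the base data -/

/-- Membership in the set of sort-1 escapes of the base section. [folklore] -/
theorem mem_Z₁ {v : V} : v ∈ Z₁ X₀ σ₀ ↔ Sum.inl v ∈ X₀ ∧ tot σ₀ (Sum.inl v) = Sum.inl none := by
  rw [Z₁, Finset.mem_filter, Finset.mem_toLeft]

/-- Membership in the set of sort-2 escapes of the base section. [folklore] -/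
theorem mem_Z₂ {w : V} : w ∈ Z₂ X₀ σ₀ ↔ Sum.inr w ∈ X₀ ∧ tot σ₀ (Sum.inr w) = Sum.inr none := by
  rw [Z₂, Finset.mem_filter, Finset.mem_toRight]

/-- Membership in the honest sort-1 part `D X` of a context. [folklore] -/
theorem mem_D {X : Finset (V ⊕ V)} {v : V} : v ∈ D X₀ σ₀ X ↔ Sum.inl v ∈ X ∧ v ∉ Z₁ X₀ σ₀ := by
  rw [D, Finset.mem_sdiff, Finset.mem_toLeft]

/-- Membership in the honest sort-2 domain of the base section. [folklore] -/
theorem mem_W₂ {w : V} : w ∈ W₂ X₀ σ₀ ↔ Sum.inr w ∈ X₀ ∧ w ∉ Z₂ X₀ σ₀ := by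
  rw [W₂, Finset.mem_sdiff, Finset.mem_toRight]

/-- The honest sort-1 part of a context is monotone in the context. [folklore] -/
theorem D_mono {X' X : Finset (V ⊕ V)} (h : X' ⊆ X) : D X₀ σ₀ X' ⊆ D X₀ σ₀ X :=
  Finset.sdiff_subset_sdiff (Finset.toLeft_subset_toLeft h) le_rfl

/-- The honest sort-1 part of a context is not larger than the context. [folklore] -/
theorem card_D_le (X : Finset (V ⊕ V)) : (D X₀ σ₀ X).card ≤ X.card :=
  (Finset.card_le_card Finset.sdiff_subset).trans Finset.card_toLeft_le

/-- The honest sort-2 domain of the base section is not larger than its context. [folklore] -/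
theorem card_W₂_le : (W₂ X₀ σ₀).card ≤ X₀.card :=
  (Finset.card_le_card Finset.sdiff_subset).trans Finset.card_toRight_le

/-- The base section has at most `|X₀|` sort-1 escapes. [folklore] -/
theorem card_Z₁_le : (Z₁ X₀ σ₀).card ≤ X₀.card :=
  (Finset.card_le_card (Finset.filter_subset _ _)).trans Finset.card_toLeft_le

/-- The honest sort-1 part commutes with restriction of contexts. [folklore] -/
theorem hon_restrict {X' X : Finset (V ⊕ V)} (hX : X' ⊆ X) (σ : ↥X → OrLinTemplate) :
    hon X₀ σ₀ X' (SectionSystem.restrict hX σ) = Finset.restrict₂ (π := fun _ => ZMod 2) (D_mono hX) (hon X₀ σ₀ X σ) := by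
  funext d
  unfold hon Finset.restrict₂
  rw [tot_restrict hX σ (mem_D.1 d.2).1]

/-- For a member of the family, the honest sort-1 domain `D X₀` is the set appearing in the goodness
clause of `𝓕`. [folklore] -/
theorem D_base_eq (hσ₀ : σ₀ ∈ fam S b₂ b₃ G r k X₀) :
    D X₀ σ₀ X₀ = X₀.toLeft.filter fun v => ∃ z, tot σ₀ (Sum.inl v) = Sum.inl (some z) := by
  obtain ⟨-, hs₁, -⟩ := hσ₀
  ext v
  rw [mem_D, Finset.mem_filter, Finset.mem_toLeft, mem_Z₁]
  constructor
  · rintro ⟨hv, hz⟩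
    obtain ⟨o, ho⟩ := hs₁ v hv
    cases o with
    | none => exact absurd ⟨hv, ho⟩ hz
    | some z => exact ⟨hv, z, ho⟩
  · rintro ⟨hv, z, hz⟩
    refine ⟨hv, fun ⟨_, h⟩ => ?_⟩
    rw [hz] at h
    cases h

/-- For a member of the family, `W₂` is the set appearing in the sort-2 goodness clause of `𝓕`. [folklore] -/
theorem W₂_eq (hσ₀ : σ₀ ∈ fam S b₂ b₃ G r k X₀) :
    W₂ X₀ σ₀ = X₀.toRight.filter fun w => ∃ z, tot σ₀ (Sum.inr w) = Sum.inr (some z) := by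
  obtain ⟨-, -, hs₂, -⟩ := hσ₀
  ext w
  rw [mem_W₂, Finset.mem_filter, Finset.mem_toRight, mem_Z₂]
  constructor
  · rintro ⟨hw, hz⟩
    obtain ⟨o, ho⟩ := hs₂ w hw
    cases o with
    | none => exact absurd ⟨hw, ho⟩ hz
    | some z => exact ⟨hw, z, ho⟩
  · rintro ⟨hw, z, hz⟩
    refine ⟨hw, fun ⟨_, h⟩ => ?_⟩
    rw [hz] at h
    cases h

/-- The honest sort-1 part of the base section is good. [folklore] -/
theorem good_h₁ (hσ₀ : σ₀ ∈ fam S b₂ b₃ G r k X₀) :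
    LinSystem.Good S b₂ r (D X₀ σ₀ X₀) (h₁ X₀ σ₀) := by
  rw [D_base_eq hσ₀]
  exact hσ₀.2.2.2.2.2.2.1

/-- The honest sort-2 part of the base section is good. [folklore] -/
theorem good_h₂ (hσ₀ : σ₀ ∈ fam S b₂ b₃ G r k X₀) :
    LinSystem.Good S b₃ r (W₂ X₀ σ₀) (h₂ X₀ σ₀) := by
  rw [W₂_eq hσ₀]
  exact hσ₀.2.2.2.2.2.2.2

/-! #### The frozen sort-2 assignment -/

variable [Fintype V] [DecidableRel G]
variable (S b₃ G r X₀ σ₀)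

/-- The `G`-neighbours of the sort-1 escapes of `σ₀` outside the context: the sort-2 variables that
must be honest in every section above `σ₀`. [folklore] -/
noncomputable def N₂ : Finset V :=
  (Finset.univ.filter fun w => ∃ v ∈ Z₁ X₀ σ₀, G v w) \ X₀.toRight

/-- A good honest extension of `h₂` to `W₂ ∪ N₂` (junk `h₂` if none exists). [folklore] -/
noncomputable def gh₂ : V → ZMod 3 :=
  open scoped Classical in
  if h : ∃ g : V → ZMod 3, LinSystem.Good S b₃ r (W₂ X₀ σ₀ ∪ N₂ G X₀ σ₀) g ∧
      ∀ w ∈ W₂ X₀ σ₀, g w = h₂ X₀ σ₀ w then h.choose else h₂ X₀ σ₀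

/-- THE GLOBAL LAZY SORT-2 ASSIGNMENT `g₂`: the escapes of `σ₀` stay escaped, `W₂ ∪ N₂` is honest (values
`gh₂`), everything else escapes to `c₂`. [folklore] -/
noncomputable def g₂ : V → Option (ZMod 3) := fun w =>
  if w ∈ Z₂ X₀ σ₀ then none
  else if w ∈ W₂ X₀ σ₀ ∪ N₂ G X₀ σ₀ then some (gh₂ S b₃ G r X₀ σ₀ w) else none

/-- The SHAPE of the sections carrying the `2`-adic family over the context `X`: sort 2 follows `g₂`,
the base escapes `Z₁` stay `c₁`, the rest of sort 1 is honest. [folklore] -/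
def Shape (X : Finset (V ⊕ V)) (σ : ↥X → OrLinTemplate) : Prop :=
  (∀ w, Sum.inr w ∈ X → tot σ (Sum.inr w) = Sum.inr (g₂ S b₃ G r X₀ σ₀ w)) ∧
  (∀ v, Sum.inl v ∈ X → v ∈ Z₁ X₀ σ₀ → tot σ (Sum.inl v) = Sum.inl none) ∧
  (∀ v, Sum.inl v ∈ X → v ∉ Z₁ X₀ σ₀ → ∃ z, tot σ (Sum.inl v) = Sum.inl (some z))

variable (b₂ k)

/-- THE `2`-ADIC WEIGHT of a section over `X`: the conditioned local distribution of the `𝔽₂`-system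
(base domain `D X₀ = W₁`, base values `h₁`) at its honest part, for sections of the right shape.
[cite: LichterPago2025, Cor. 4.13 and proof of Thm 5.9 (p-solutions with a fixed local section)] -/
noncomputable def wt (X : Finset (V ⊕ V)) (σ : ↥X → OrLinTemplate) : ℚ :=
  open scoped Classical in
  if X.card ≤ k ∧ Shape S b₃ G r X₀ σ₀ X σ then
    LinSystem.locMeasure S b₂ r (D X₀ σ₀ X₀) (h₁ X₀ σ₀) (D X₀ σ₀ X) (hon X₀ σ₀ X σ) else 0

variable {b₂ k}

/-- The section of shape `Shape` over `X` with prescribed honest sort-1 part `t`. [folklore] -/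
noncomputable def emb (X : Finset (V ⊕ V)) (t : ↥(D X₀ σ₀ X) → ZMod 2) : ↥X → OrLinTemplate :=
  fun x => match x with
    | ⟨Sum.inl v, hx⟩ =>
        if hv : v ∈ Z₁ X₀ σ₀ then Sum.inl none
        else Sum.inl (some (t ⟨v, Finset.mem_sdiff.2 ⟨Finset.mem_toLeft.2 hx, hv⟩⟩))
    | ⟨Sum.inr w, _⟩ => Sum.inr (g₂ S b₃ G r X₀ σ₀ w)

variable {S b₃ G r X₀ σ₀}
variable {d : ℕ}

/-- Membership in the forced-honest set `N₂`. [folklore] -/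
theorem mem_N₂ {w : V} : w ∈ N₂ G X₀ σ₀ ↔ (∃ v ∈ Z₁ X₀ σ₀, G v w) ∧ Sum.inr w ∉ X₀ := by
  unfold N₂
  rw [Finset.mem_sdiff, Finset.mem_toRight, Finset.mem_filter]
  simp only [Finset.mem_univ, true_and]

/-- Size of the forced-honest set: `|N₂| ≤ d |Z₁|` for out-degrees `≤ d`. [folklore] -/
theorem card_N₂_le (hdeg : ∀ v : V, (Finset.univ.filter fun w => G v w).card ≤ d) :
    (N₂ G X₀ σ₀).card ≤ d * (Z₁ X₀ σ₀).card := by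
  unfold N₂
  calc ((Finset.univ.filter fun w => ∃ v ∈ Z₁ X₀ σ₀, G v w) \ X₀.toRight).card
      ≤ (Finset.univ.filter fun w => ∃ v ∈ Z₁ X₀ σ₀, G v w).card :=
        Finset.card_le_card Finset.sdiff_subset
    _ ≤ ((Z₁ X₀ σ₀).biUnion fun v => Finset.univ.filter fun w => G v w).card := by
        refine Finset.card_le_card fun w hw => ?_
        rw [Finset.mem_filter] at hw
        obtain ⟨v, hv, hvw⟩ := hw.2
        exact Finset.mem_biUnion.2 ⟨v, hv, Finset.mem_filter.2 ⟨Finset.mem_univ _, hvw⟩⟩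
    _ ≤ ∑ v ∈ Z₁ X₀ σ₀, (Finset.univ.filter fun w => G v w).card := Finset.card_biUnion_le
    _ ≤ ∑ _v ∈ Z₁ X₀ σ₀, d := Finset.sum_le_sum fun v _ => hdeg v
    _ = d * (Z₁ X₀ σ₀).card := by rw [Finset.sum_const, smul_eq_mul, mul_comm]

/-- The defining property of `gh₂` (under the hypotheses that make the extension exist): good on
`W₂ ∪ N₂`, equal to `h₂` on `W₂`. [folklore] -/
theorem gh₂_spec (hexp : ∀ T : Finset U, T.card ≤ r → 1 * T.card ≤ 2 * (XorSystem.boundary S T).card)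
    (hdeg : ∀ v : V, (Finset.univ.filter fun w => G v w).card ≤ d) (hkr : 4 * (d + 2) * k ≤ r)
    (hσ₀ : σ₀ ∈ fam S b₂ b₃ G r k X₀) :
    LinSystem.Good S b₃ r (W₂ X₀ σ₀ ∪ N₂ G X₀ σ₀) (gh₂ S b₃ G r X₀ σ₀) ∧
      ∀ w ∈ W₂ X₀ σ₀, gh₂ S b₃ G r X₀ σ₀ w = h₂ X₀ σ₀ w := by
  classical
  have hk : X₀.card ≤ k := hσ₀.1
  have h1 : (W₂ X₀ σ₀).card ≤ k := card_W₂_le.trans hk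
  have h2 : (N₂ G X₀ σ₀).card ≤ d * k :=
    (card_N₂_le hdeg).trans (Nat.mul_le_mul_left d (card_Z₁_le.trans hk))
  have h3 : (W₂ X₀ σ₀ ∪ N₂ G X₀ σ₀).card ≤ k + d * k :=
    (Finset.card_union_le _ _).trans (Nat.add_le_add h1 h2)
  have hex : ∃ g : V → ZMod 3, LinSystem.Good S b₃ r (W₂ X₀ σ₀ ∪ N₂ G X₀ σ₀) g ∧
      ∀ w ∈ W₂ X₀ σ₀, g w = h₂ X₀ σ₀ w := by
    refine (good_h₂ hσ₀).extend Nat.one_pos hexp Finset.subset_union_left ?_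
    nlinarith [hkr, h3]
  unfold gh₂
  rw [dif_pos hex]
  exact hex.choose_spec

/-- Where the frozen sort-2 assignment escapes. [folklore] -/
theorem g₂_eq_none_iff {w : V} :
    g₂ S b₃ G r X₀ σ₀ w = none ↔ w ∈ Z₂ X₀ σ₀ ∨ w ∉ W₂ X₀ σ₀ ∪ N₂ G X₀ σ₀ := by
  unfold g₂
  by_cases h1 : w ∈ Z₂ X₀ σ₀
  · simp [h1]
  · by_cases h2 : w ∈ W₂ X₀ σ₀ ∪ N₂ G X₀ σ₀ <;> simp [h1, h2]

/-- Where the frozen sort-2 assignment is honest, its value is `gh₂`. [folklore] -/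
theorem g₂_eq_some {w : V} (h1 : w ∉ Z₂ X₀ σ₀) (h2 : w ∈ W₂ X₀ σ₀ ∪ N₂ G X₀ σ₀) :
    g₂ S b₃ G r X₀ σ₀ w = some (gh₂ S b₃ G r X₀ σ₀ w) := by
  unfold g₂
  rw [if_neg h1, if_pos h2]

/-- The honest values of the frozen sort-2 assignment. [folklore] -/
theorem g₂_eq_some_iff {w : V} {z : ZMod 3} :
    g₂ S b₃ G r X₀ σ₀ w = some z ↔
      w ∉ Z₂ X₀ σ₀ ∧ w ∈ W₂ X₀ σ₀ ∪ N₂ G X₀ σ₀ ∧ gh₂ S b₃ G r X₀ σ₀ w = z := by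
  unfold g₂
  by_cases h1 : w ∈ Z₂ X₀ σ₀
  · simp [h1]
  · by_cases h2 : w ∈ W₂ X₀ σ₀ ∪ N₂ G X₀ σ₀ <;> simp [h1, h2]

/-- `g₂` agrees with the base section on its context. [folklore] -/
theorem g₂_base (hexp : ∀ T : Finset U, T.card ≤ r → 1 * T.card ≤ 2 * (XorSystem.boundary S T).card)
    (hdeg : ∀ v : V, (Finset.univ.filter fun w => G v w).card ≤ d) (hkr : 4 * (d + 2) * k ≤ r)
    (hσ₀ : σ₀ ∈ fam S b₂ b₃ G r k X₀) {w : V} (hw : Sum.inr w ∈ X₀) :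
    Sum.inr (g₂ S b₃ G r X₀ σ₀ w) = tot σ₀ (Sum.inr w) := by
  by_cases hZ : w ∈ Z₂ X₀ σ₀
  · rw [(g₂_eq_none_iff).2 (Or.inl hZ), (mem_Z₂.1 hZ).2]
  · have hW : w ∈ W₂ X₀ σ₀ := mem_W₂.2 ⟨hw, hZ⟩
    rw [g₂_eq_some hZ (Finset.mem_union_left _ hW), (gh₂_spec hexp hdeg hkr hσ₀).2 w hW]
    obtain ⟨o, ho⟩ := hσ₀.2.2.1 w hw
    cases o with
    | none => exact absurd (mem_Z₂.2 ⟨hw, ho⟩) hZ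
    | some z => rw [ho]; unfold h₂; rw [ho]; rfl

/-- The base section has the shape. [folklore] -/
theorem shape_base (hexp : ∀ T : Finset U, T.card ≤ r → 1 * T.card ≤ 2 * (XorSystem.boundary S T).card)
    (hdeg : ∀ v : V, (Finset.univ.filter fun w => G v w).card ≤ d) (hkr : 4 * (d + 2) * k ≤ r)
    (hσ₀ : σ₀ ∈ fam S b₂ b₃ G r k X₀) : Shape S b₃ G r X₀ σ₀ X₀ σ₀ := by
  refine ⟨fun w hw => (g₂_base hexp hdeg hkr hσ₀ hw).symm, fun v _ hv => (mem_Z₁.1 hv).2,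
    fun v hv hvZ => ?_⟩
  obtain ⟨o, ho⟩ := hσ₀.2.1 v hv
  cases o with
  | none => exact absurd (mem_Z₁.2 ⟨hv, ho⟩) hvZ
  | some z => exact ⟨z, ho⟩

/-! #### The embedding `emb` and the honest part `hon` -/

/-- Sort-1 values of the embedded section: `c₁` on the base escapes, the prescribed honest values elsewhere. [folklore] -/
theorem tot_emb_inl {X : Finset (V ⊕ V)} (t : ↥(D X₀ σ₀ X) → ZMod 2) {v : V} (hv : Sum.inl v ∈ X) :
    tot (emb S b₃ G r X₀ σ₀ X t) (Sum.inl v) =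
      if hZ : v ∈ Z₁ X₀ σ₀ then Sum.inl none
      else Sum.inl (some (t ⟨v, mem_D.2 ⟨hv, hZ⟩⟩)) := by
  rw [tot_of_mem _ hv]
  unfold emb
  simp only
  split_ifs <;> rfl

/-- Sort-2 values of the embedded section follow the frozen assignment `g₂`. [folklore] -/
theorem tot_emb_inr {X : Finset (V ⊕ V)} (t : ↥(D X₀ σ₀ X) → ZMod 2) {w : V} (hw : Sum.inr w ∈ X) :
    tot (emb S b₃ G r X₀ σ₀ X t) (Sum.inr w) = Sum.inr (g₂ S b₃ G r X₀ σ₀ w) := by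
  rw [tot_of_mem _ hw]
  rfl

/-- Embedded sections have the shape. [folklore] -/
theorem shape_emb {X : Finset (V ⊕ V)} (t : ↥(D X₀ σ₀ X) → ZMod 2) :
    Shape S b₃ G r X₀ σ₀ X (emb S b₃ G r X₀ σ₀ X t) := by
  refine ⟨fun w hw => tot_emb_inr t hw, fun v hv hZ => ?_, fun v hv hZ => ?_⟩
  · rw [tot_emb_inl t hv, dif_pos hZ]
  · exact ⟨_, by rw [tot_emb_inl t hv, dif_neg hZ]⟩

/-- The honest part of the embedded section is the prescribed one. [folklore] -/
theorem hon_emb {X : Finset (V ⊕ V)} (t : ↥(D X₀ σ₀ X) → ZMod 2) :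
    hon X₀ σ₀ X (emb S b₃ G r X₀ σ₀ X t) = t := by
  funext d
  have hd := mem_D.1 d.2
  unfold hon
  rw [tot_emb_inl t hd.1, dif_neg hd.2]
  rfl

/-- A section of the right shape is the embedding of its honest part. [folklore] -/
theorem emb_hon {X : Finset (V ⊕ V)} {σ : ↥X → OrLinTemplate} (hσ : Shape S b₃ G r X₀ σ₀ X σ) :
    emb S b₃ G r X₀ σ₀ X (hon X₀ σ₀ X σ) = σ := by
  refine eq_of_tot_eq fun x hx => ?_
  obtain ⟨hr₂, hz, hh⟩ := hσ
  cases x with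
  | inl v =>
    rw [tot_emb_inl _ hx]
    by_cases hZ : v ∈ Z₁ X₀ σ₀
    · rw [dif_pos hZ, hz v hx hZ]
    · rw [dif_neg hZ]
      obtain ⟨z, hzv⟩ := hh v hx hZ
      rw [hzv]
      unfold hon
      simp only [hzv, hv₁_inl_some]
  | inr w => rw [tot_emb_inr _ hx, hr₂ w hx]

/-- The embedding of honest parts is injective. [folklore] -/
theorem emb_injective (X : Finset (V ⊕ V)) : Function.Injective (emb S b₃ G r X₀ σ₀ X) :=
  fun t₁ t₂ h => by rw [← hon_emb (S := S) (b₃ := b₃) (G := G) (r := r) t₁, h, hon_emb]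

/-- The shape is preserved under restriction of contexts. [folklore] -/
theorem shape_restrict {X' X : Finset (V ⊕ V)} (hX : X' ⊆ X) {σ : ↥X → OrLinTemplate}
    (hσ : Shape S b₃ G r X₀ σ₀ X σ) : Shape S b₃ G r X₀ σ₀ X' (SectionSystem.restrict hX σ) := by
  obtain ⟨hr₂, hz, hh⟩ := hσ
  refine ⟨fun w hw => ?_, fun v hv hZ => ?_, fun v hv hZ => ?_⟩
  · rw [tot_restrict hX σ hw, hr₂ w (hX hw)]
  · rw [tot_restrict hX σ hv, hz v (hX hv) hZ]
  · rw [tot_restrict hX σ hv]; exact hh v (hX hv) hZ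

/-- Restriction of an embedded section is the embedding of the restricted honest part. [folklore] -/
theorem restrict_emb {X' X : Finset (V ⊕ V)} (hX : X' ⊆ X) (t : ↥(D X₀ σ₀ X) → ZMod 2) :
    SectionSystem.restrict hX (emb S b₃ G r X₀ σ₀ X t) =
      emb S b₃ G r X₀ σ₀ X' (Finset.restrict₂ (π := fun _ => ZMod 2) (D_mono hX) t) := by
  rw [← emb_hon (shape_restrict hX (shape_emb t)), hon_restrict, hon_emb]

open scoped Classical in
/-- The sections of the right shape over `X` are exactly the embedded honest sections. [folklore] -/
theorem filter_shape_eq_image (X : Finset (V ⊕ V)) :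
    (Finset.univ.filter fun σ => Shape S b₃ G r X₀ σ₀ X σ) =
      Finset.univ.image (emb S b₃ G r X₀ σ₀ X) := by
  ext σ
  rw [Finset.mem_filter, Finset.mem_image]
  constructor
  · rintro ⟨-, h⟩
    exact ⟨_, Finset.mem_univ _, emb_hon h⟩
  · rintro ⟨t, -, ht⟩
    exact ⟨Finset.mem_univ _, ht ▸ shape_emb t⟩

/-! #### Support: sections of non-zero weight are in the family -/

/-- **Support of the `2`-adic family.** A section of non-zero weight belongs to `𝓕`.
[cite: LichterPago2025, proof of Thm 5.9 (the p-solutions are supported on H)] -/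
theorem mem_fam_of_wt_ne_zero (hr : 1 ≤ r)
    (hexp : ∀ T : Finset U, T.card ≤ r → 1 * T.card ≤ 2 * (XorSystem.boundary S T).card)
    (hdeg : ∀ v : V, (Finset.univ.filter fun w => G v w).card ≤ d) (hkr : 4 * (d + 2) * k ≤ r)
    (hσ₀ : σ₀ ∈ fam S b₂ b₃ G r k X₀) {X : Finset (V ⊕ V)} {σ : ↥X → OrLinTemplate}
    (hw : wt S b₂ b₃ G r k X₀ σ₀ X σ ≠ 0) : σ ∈ fam S b₂ b₃ G r k X := by
  classical
  unfold wt at hw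
  split_ifs at hw with hcond
  swap; · exact absurd rfl hw
  obtain ⟨hXk, hshape⟩ := hcond
  obtain ⟨hr₂, hz, hh⟩ := hshape
  obtain ⟨x, hxgood, -, hxt⟩ := LinSystem.exists_of_locMeasure_ne_zero hw
  obtain ⟨hgood₂, -⟩ := gh₂_spec hexp hdeg hkr hσ₀
  -- honest sort-1 values are those of `x` on `D X`
  have hxv : ∀ v (hv : v ∈ D X₀ σ₀ X), x v = hv₁ (tot σ (Sum.inl v)) := fun v hv => hxt ⟨v, hv⟩
  refine ⟨hXk, fun v hv => ?_, fun w hw => ⟨_, hr₂ w hw⟩, fun u hu => ?_, fun u hu => ?_,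
    fun v w hvw hv hw hesc => ?_, ?_, ?_⟩
  · by_cases hZ : v ∈ Z₁ X₀ σ₀
    · exact ⟨none, hz v hv hZ⟩
    · obtain ⟨z, hzv⟩ := hh v hv hZ
      exact ⟨some z, hzv⟩
  · -- an `𝔽₂`-equation inside the context
    by_cases hesc : ∃ v ∈ S u, v ∈ Z₁ X₀ σ₀
    · obtain ⟨v, hv, hvZ⟩ := hesc
      exact Or.inl ⟨v, hv, hz v (hu v hv) hvZ⟩
    · right
      have hD : ∀ v ∈ S u, v ∈ D X₀ σ₀ X := fun v hv =>
        mem_D.2 ⟨hu v hv, fun hvZ => hesc ⟨v, hv, hvZ⟩⟩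
      refine ⟨fun v hv => hh v (hu v hv) (mem_D.1 (hD v hv)).2, ?_⟩
      rw [← Finset.sum_congr rfl fun v hv => hxv v (hD v hv)]
      exact (hxgood.mono Finset.subset_union_right).sum_eq hr fun v hv => hD v hv
  · -- an `𝔽₃`-equation inside the context
    by_cases hesc : ∃ w ∈ S u, g₂ S b₃ G r X₀ σ₀ w = none
    · obtain ⟨w, hw, hwn⟩ := hesc
      exact Or.inl ⟨w, hw, by rw [hr₂ w (hu w hw), hwn]⟩
    · right
      have hsome : ∀ w ∈ S u, g₂ S b₃ G r X₀ σ₀ w = some (gh₂ S b₃ G r X₀ σ₀ w) := by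
        intro w hw
        cases hgw : g₂ S b₃ G r X₀ σ₀ w with
        | none => exact absurd ⟨w, hw, hgw⟩ hesc
        | some z => rw [((g₂_eq_some_iff).1 hgw).2.2]
      have hWN : ∀ w ∈ S u, w ∈ W₂ X₀ σ₀ ∪ N₂ G X₀ σ₀ := fun w hw =>
        ((g₂_eq_some_iff).1 (hsome w hw)).2.1
      refine ⟨fun w hw => ⟨_, by rw [hr₂ w (hu w hw), hsome w hw]⟩, ?_⟩
      have : ∀ w ∈ S u, hv₂ (tot σ (Sum.inr w)) = gh₂ S b₃ G r X₀ σ₀ w := fun w hw => by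
        rw [hr₂ w (hu w hw), hsome w hw]; rfl
      rw [Finset.sum_congr rfl this]
      exact hgood₂.sum_eq hr fun w hw => hWN w hw
  · -- no `G`-edge carries `(c₁, c₂)`
    have hvZ : v ∈ Z₁ X₀ σ₀ := by
      by_contra hvZ
      obtain ⟨z, hzv⟩ := hh v hv hvZ
      rw [hzv] at hesc
      cases hesc
    rw [hr₂ w hw]
    intro hnone
    have hg : g₂ S b₃ G r X₀ σ₀ w = none := Sum.inr_injective hnone
    rcases (g₂_eq_none_iff).1 hg with hwZ | hwWN
    · obtain ⟨hw₀, hw₀t⟩ := mem_Z₂.1 hwZ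
      obtain ⟨hv₀, hv₀t⟩ := mem_Z₁.1 hvZ
      exact hσ₀.2.2.2.2.2.1 v w hvw hv₀ hw₀ hv₀t hw₀t
    · apply hwWN
      by_cases hw₀ : Sum.inr w ∈ X₀
      · refine Finset.mem_union_left _ (mem_W₂.2 ⟨hw₀, fun hwZ => ?_⟩)
        obtain ⟨hv₀, hv₀t⟩ := mem_Z₁.1 hvZ
        exact hσ₀.2.2.2.2.2.1 v w hvw hv₀ hw₀ hv₀t (mem_Z₂.1 hwZ).2
      · exact Finset.mem_union_right _ (mem_N₂.2 ⟨⟨v, hvZ, hvw⟩, hw₀⟩)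
  · -- goodness of the honest sort-1 part
    have hset : (X.toLeft.filter fun v => ∃ z, tot σ (Sum.inl v) = Sum.inl (some z)) = D X₀ σ₀ X := by
      ext v
      rw [Finset.mem_filter, Finset.mem_toLeft, mem_D]
      constructor
      · rintro ⟨hv, z, hzv⟩
        refine ⟨hv, fun hZ => ?_⟩
        rw [hz v hv hZ] at hzv
        cases hzv
      · rintro ⟨hv, hZ⟩
        exact ⟨hv, hh v hv hZ⟩
    rw [hset]
    exact (hxgood.mono Finset.subset_union_right).congr fun v hv => hxv v hv
  · -- goodness of the honest sort-2 part
    have hsub : (X.toRight.filter fun w => ∃ z, tot σ (Sum.inr w) = Sum.inr (some z)) ⊆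
        W₂ X₀ σ₀ ∪ N₂ G X₀ σ₀ := by
      intro w hw
      rw [Finset.mem_filter, Finset.mem_toRight] at hw
      obtain ⟨hw, z, hzw⟩ := hw
      rw [hr₂ w hw] at hzw
      exact ((g₂_eq_some_iff).1 (Sum.inr_injective hzw)).2.1
    refine (hgood₂.mono hsub).congr fun w hw => ?_
    rw [Finset.mem_filter, Finset.mem_toRight] at hw
    obtain ⟨hw, z, hzw⟩ := hw
    have hg : g₂ S b₃ G r X₀ σ₀ w = some z := Sum.inr_injective ((hr₂ w hw).symm.trans hzw)
    show gh₂ S b₃ G r X₀ σ₀ w = hv₂ (tot σ (Sum.inr w))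
    rw [hzw, hv₂_inr_some]
    exact ((g₂_eq_some_iff).1 hg).2.2

/-! #### Compatibility and base -/

/-- **Compatibility of the `2`-adic family** under restriction of contexts.
[cite: LichterPago2025, Lemma 4.7 and Lemma 3.7 (solutions of the width-k system transfer)] -/
theorem sum_wt_restrict
    (hexp : ∀ T : Finset U, T.card ≤ r → 1 * T.card ≤ 2 * (XorSystem.boundary S T).card)
    (hkr : 4 * (d + 2) * k ≤ r) (hσ₀ : σ₀ ∈ fam S b₂ b₃ G r k X₀)
    {X' X : Finset (V ⊕ V)} (hX : X' ⊆ X) (hXk : X.card ≤ k) (τ : ↥X' → OrLinTemplate) :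
    ∑ σ : ↥X → OrLinTemplate,
        (if SectionSystem.restrict hX σ = τ then wt S b₂ b₃ G r k X₀ σ₀ X σ else 0) =
      wt S b₂ b₃ G r k X₀ σ₀ X' τ := by
  classical
  have hX'k : X'.card ≤ k := (Finset.card_le_card hX).trans hXk
  have hWD : 2 * 2 * (D X₀ σ₀ X₀ ∪ D X₀ σ₀ X).card ≤ 1 * r := by
    have h1 : (D X₀ σ₀ X₀ ∪ D X₀ σ₀ X).card ≤ k + k :=
      (Finset.card_union_le _ _).trans (Nat.add_le_add ((card_D_le X₀).trans hσ₀.1)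
        ((card_D_le X).trans hXk))
    nlinarith [hkr, h1]
  by_cases hτ : Shape S b₃ G r X₀ σ₀ X' τ
  · -- restrict the sum to sections of the right shape, reindex by honest parts
    have hzero : ∀ σ : ↥X → OrLinTemplate, ¬ Shape S b₃ G r X₀ σ₀ X σ →
        (if SectionSystem.restrict hX σ = τ then wt S b₂ b₃ G r k X₀ σ₀ X σ else 0) = 0 := by
      intro σ hσ
      rw [ite_eq_right_iff]
      intro _
      unfold wt
      rw [if_neg (fun h => hσ h.2)]
    rw [← Finset.sum_subset (Finset.subset_univ (Finset.univ.filter fun σ => Shape S b₃ G r X₀ σ₀ X σ))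
      (fun σ _ hσ => hzero σ (fun h => hσ (Finset.mem_filter.2 ⟨Finset.mem_univ _, h⟩))),
      filter_shape_eq_image, Finset.sum_image fun t₁ _ t₂ _ h => emb_injective X h]
    have hterm : ∀ t : ↥(D X₀ σ₀ X) → ZMod 2,
        (if SectionSystem.restrict hX (emb S b₃ G r X₀ σ₀ X t) = τ then
            wt S b₂ b₃ G r k X₀ σ₀ X (emb S b₃ G r X₀ σ₀ X t) else 0) =
          if Finset.restrict₂ (π := fun _ => ZMod 2) (D_mono hX) t = hon X₀ σ₀ X' τ then
            LinSystem.locMeasure S b₂ r (D X₀ σ₀ X₀) (h₁ X₀ σ₀) (D X₀ σ₀ X) t else 0 := by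
      intro t
      have hiff : SectionSystem.restrict hX (emb S b₃ G r X₀ σ₀ X t) = τ ↔
          Finset.restrict₂ (π := fun _ => ZMod 2) (D_mono hX) t = hon X₀ σ₀ X' τ := by
        rw [restrict_emb]
        constructor
        · intro h; rw [← h, hon_emb]
        · intro h; rw [h, emb_hon hτ]
      by_cases h : Finset.restrict₂ (π := fun _ => ZMod 2) (D_mono hX) t = hon X₀ σ₀ X' τ
      · rw [if_pos (hiff.2 h), if_pos h]
        unfold wt
        rw [if_pos ⟨hXk, shape_emb t⟩, hon_emb]
      · rw [if_neg (fun h' => h (hiff.1 h')), if_neg h]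
    rw [Finset.sum_congr rfl fun t _ => hterm t,
      LinSystem.sum_locMeasure_restrict Nat.one_pos hexp (D_mono hX) hWD]
    unfold wt
    rw [if_pos ⟨hX'k, hτ⟩]
  · -- wrong shape: both sides vanish
    have hrhs : wt S b₂ b₃ G r k X₀ σ₀ X' τ = 0 := by
      unfold wt; rw [if_neg (fun h => hτ h.2)]
    rw [hrhs]
    refine Finset.sum_eq_zero fun σ _ => ?_
    rw [ite_eq_right_iff]
    rintro rfl
    by_contra hne
    unfold wt at hne
    split_ifs at hne with hcond
    · exact hτ (shape_restrict hX hcond.2)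
    · exact hne rfl

/-- **Base of the `2`-adic family**: over the base context the weight is the indicator of `σ₀`.
[cite: LichterPago2025, Cor. 4.13 (the p-solution sets x_{Z,f} = 1)] -/
theorem wt_base (hexp : ∀ T : Finset U, T.card ≤ r → 1 * T.card ≤ 2 * (XorSystem.boundary S T).card)
    (hdeg : ∀ v : V, (Finset.univ.filter fun w => G v w).card ≤ d) (hkr : 4 * (d + 2) * k ≤ r)
    (hσ₀ : σ₀ ∈ fam S b₂ b₃ G r k X₀) (τ : ↥X₀ → OrLinTemplate) :
    wt S b₂ b₃ G r k X₀ σ₀ X₀ τ = if τ = σ₀ then 1 else 0 := by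
  classical
  have hW : 2 * 2 * (D X₀ σ₀ X₀).card ≤ 1 * r := by
    have := (card_D_le (X₀ := X₀) (σ₀ := σ₀) X₀).trans hσ₀.1
    nlinarith [hkr]
  have hbase : hon X₀ σ₀ X₀ σ₀ = (D X₀ σ₀ X₀).restrict (h₁ X₀ σ₀) := rfl
  have hsh := shape_base hexp hdeg hkr hσ₀
  unfold wt
  by_cases hτσ : τ = σ₀
  · subst hτσ
    rw [if_pos ⟨hσ₀.1, hsh⟩, if_pos rfl,
      LinSystem.locMeasure_self Nat.one_pos hexp hW (good_h₁ hσ₀), if_pos hbase]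
  · rw [if_neg hτσ]
    split_ifs with hcond
    · rw [LinSystem.locMeasure_self Nat.one_pos hexp hW (good_h₁ hσ₀), if_neg]
      intro heq
      apply hτσ
      calc τ = emb S b₃ G r X₀ σ₀ X₀ (hon X₀ σ₀ X₀ τ) := (emb_hon hcond.2).symm
        _ = emb S b₃ G r X₀ σ₀ X₀ (hon X₀ σ₀ X₀ σ₀) := by rw [heq, ← hbase]
        _ = σ₀ := emb_hon hsh
    · rfl

/-- **Integrality after scaling by `2^k`.** [cite: LichterPago2025, Lemma 2.2] -/
theorem exists_int_two_pow_mul_wt (X : Finset (V ⊕ V)) (σ : ↥X → OrLinTemplate) :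
    ∃ z : ℤ, ((2 ^ k : ℕ) : ℚ) * wt S b₂ b₃ G r k X₀ σ₀ X σ = z := by
  classical
  unfold wt
  split_ifs with hcond
  · haveI : Fact (Nat.Prime 2) := ⟨Nat.prime_two⟩
    obtain ⟨n, hn⟩ := LinSystem.exists_nat_eq_pow_mul_locMeasure (S := S) (b := b₂) (r := r)
      (W := D X₀ σ₀ X₀) (h := h₁ X₀ σ₀) (D := D X₀ σ₀ X) (hon X₀ σ₀ X σ)
    have hle : (D X₀ σ₀ X).card ≤ k := (card_D_le X).trans hcond.1
    have hn' : (n : ℚ) = 2 ^ (D X₀ σ₀ X).card *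
        LinSystem.locMeasure S b₂ r (D X₀ σ₀ X₀) (h₁ X₀ σ₀) (D X₀ σ₀ X) (hon X₀ σ₀ X σ) := by
      simpa using hn
    refine ⟨((2 ^ (k - (D X₀ σ₀ X).card) * n : ℕ) : ℤ), ?_⟩
    push_cast
    rw [hn', ← mul_assoc, ← pow_add, Nat.sub_add_cancel hle]
  · exact ⟨0, by simp⟩

/-- **The `2`-adic family is a rational linear section of `𝓕` based at `σ₀`.**
[cite: LichterPago2025, proof of Thm 5.9 (stability of H under the cohomological algorithm, p-solution part)] -/
theorem isRatSection_wt (hr : 1 ≤ r)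
    (hexp : ∀ T : Finset U, T.card ≤ r → 1 * T.card ≤ 2 * (XorSystem.boundary S T).card)
    (hdeg : ∀ v : V, (Finset.univ.filter fun w => G v w).card ≤ d) (hkr : 4 * (d + 2) * k ≤ r)
    (hσ₀ : σ₀ ∈ fam S b₂ b₃ G r k X₀) :
    SectionSystem.IsRatSection k (fam S b₂ b₃ G r k) X₀ σ₀ (wt S b₂ b₃ G r k X₀ σ₀) :=
  ⟨fun _ _ hw => mem_fam_of_wt_ne_zero hr hexp hdeg hkr hσ₀ hw,
    fun _ _ hX hXk τ => sum_wt_restrict hexp hkr hσ₀ hX hXk τ,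
    fun τ => wt_base hexp hdeg hkr hσ₀ τ⟩

end TwoAdic

/-! ### The `3`-adic rational linear section above a member of the family (the mirror image)

The same construction with the sorts exchanged: sort 2 is distributed according to the local
distribution of the `𝔽₃`-system conditioned on the honest part `h₂` of `σ₀`, sort 1 is frozen to one
global lazy assignment `g₁`.  (The statements mirror those of the previous section line by line; only
the link relation, which is directed from sort 1 to sort 2, breaks the symmetry.) -/

section ThreeAdic

variable (X₀ : Finset (V ⊕ V)) (σ₀ : ↥X₀ → OrLinTemplate)

/-- The honest sort-2 part `D X = X₁ ∖ Z₂` of a context `X` (for the base context this is the honest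
domain `W₂` of `σ₀`). [folklore] -/
noncomputable def E (X : Finset (V ⊕ V)) : Finset V := X.toRight \ Z₂ X₀ σ₀

/-- The honest sort-2 part of a section over `X`, as a section of the `𝔽₃`-system over `D X`. [folklore] -/
noncomputable def hon₃ (X : Finset (V ⊕ V)) (σ : ↥X → OrLinTemplate) : ↥(E X₀ σ₀ X) → ZMod 3 :=
  fun d => hv₂ (tot σ (Sum.inr (d : V)))

variable {X₀ σ₀}

/-! #### Elementary facts about the base data -/

/-- Membership in the honest sort-2 part `E X` of a context. [folklore] -/
theorem mem_E {X : Finset (V ⊕ V)} {v : V} : v ∈ E X₀ σ₀ X ↔ Sum.inr v ∈ X ∧ v ∉ Z₂ X₀ σ₀ := by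
  rw [E, Finset.mem_sdiff, Finset.mem_toRight]

/-- The honest sort-2 part of a context is monotone in the context. [folklore] -/
theorem E_mono {X' X : Finset (V ⊕ V)} (h : X' ⊆ X) : E X₀ σ₀ X' ⊆ E X₀ σ₀ X :=
  Finset.sdiff_subset_sdiff (Finset.toRight_subset_toRight h) le_rfl

/-- The honest sort-2 part of a context is not larger than the context. [folklore] -/
theorem card_E_le (X : Finset (V ⊕ V)) : (E X₀ σ₀ X).card ≤ X.card :=
  (Finset.card_le_card Finset.sdiff_subset).trans Finset.card_toRight_le

/-- The base section has at most `|X₀|` sort-2 escapes. [folklore] -/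
theorem card_Z₂_le : (Z₂ X₀ σ₀).card ≤ X₀.card :=
  (Finset.card_le_card (Finset.filter_subset _ _)).trans Finset.card_toRight_le

/-- The honest sort-2 part commutes with restriction of contexts. [folklore] -/
theorem hon₃_restrict {X' X : Finset (V ⊕ V)} (hX : X' ⊆ X) (σ : ↥X → OrLinTemplate) :
    hon₃ X₀ σ₀ X' (SectionSystem.restrict hX σ) = Finset.restrict₂ (π := fun _ => ZMod 3) (E_mono hX) (hon₃ X₀ σ₀ X σ) := by
  funext d
  unfold hon₃ Finset.restrict₂
  rw [tot_restrict hX σ (mem_E.1 d.2).1]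

/-- For a member of the family, the honest sort-2 domain `D X₀` is the set appearing in the goodness
clause of `𝓕`. [folklore] -/
theorem E_base_eq (hσ₀ : σ₀ ∈ fam S b₂ b₃ G r k X₀) :
    E X₀ σ₀ X₀ = X₀.toRight.filter fun v => ∃ z, tot σ₀ (Sum.inr v) = Sum.inr (some z) := by
  obtain ⟨-, -, hs₁, -⟩ := hσ₀
  ext v
  rw [mem_E, Finset.mem_filter, Finset.mem_toRight, mem_Z₂]
  constructor
  · rintro ⟨hv, hz⟩
    obtain ⟨o, ho⟩ := hs₁ v hv
    cases o with
    | none => exact absurd ⟨hv, ho⟩ hz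
    | some z => exact ⟨hv, z, ho⟩
  · rintro ⟨hv, z, hz⟩
    refine ⟨hv, fun ⟨_, h⟩ => ?_⟩
    rw [hz] at h
    cases h

/-- The honest sort-2 part of the base section is good (domain written as `E X₀`). [folklore] -/
theorem good_h₂_E (hσ₀ : σ₀ ∈ fam S b₂ b₃ G r k X₀) :
    LinSystem.Good S b₃ r (E X₀ σ₀ X₀) (h₂ X₀ σ₀) := by
  rw [E_base_eq hσ₀]
  exact hσ₀.2.2.2.2.2.2.2

/-! #### The frozen sort-1 assignment -/

variable [Fintype V] [DecidableRel G]
variable (S b₂ G r X₀ σ₀)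

/-- The `G`-predecessors of the sort-2 escapes of `σ₀` outside the context: the sort-1 variables that
must be honest in every section above `σ₀`. [folklore] -/
noncomputable def N₁ : Finset V :=
  (Finset.univ.filter fun v => ∃ w ∈ Z₂ X₀ σ₀, G v w) \ X₀.toLeft

/-- A good honest extension of `h₁` to `E0 ∪ N₁` (junk `h₁` if none exists). [folklore] -/
noncomputable def gh₁ : V → ZMod 2 :=
  open scoped Classical in
  if h : ∃ g : V → ZMod 2, LinSystem.Good S b₂ r (D X₀ σ₀ X₀ ∪ N₁ G X₀ σ₀) g ∧
      ∀ w ∈ D X₀ σ₀ X₀, g w = h₁ X₀ σ₀ w then h.choose else h₁ X₀ σ₀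

/-- THE GLOBAL LAZY SORT-2 ASSIGNMENT `g₁`: the escapes of `σ₀` stay escaped, `E0 ∪ N₁` is honest (values
`gh₁`), everything else escapes to `c₁`. [folklore] -/
noncomputable def g₁ : V → Option (ZMod 2) := fun w =>
  if w ∈ Z₁ X₀ σ₀ then none
  else if w ∈ D X₀ σ₀ X₀ ∪ N₁ G X₀ σ₀ then some (gh₁ S b₂ G r X₀ σ₀ w) else none

/-- The SHAPE of the sections carrying the `3`-adic family over the context `X`: sort 1 follows `g₁`,
the base escapes `Z₂` stay `c₂`, the rest of sort 2 is honest. [folklore] -/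
def Shape₃ (X : Finset (V ⊕ V)) (σ : ↥X → OrLinTemplate) : Prop :=
  (∀ w, Sum.inl w ∈ X → tot σ (Sum.inl w) = Sum.inl (g₁ S b₂ G r X₀ σ₀ w)) ∧
  (∀ v, Sum.inr v ∈ X → v ∈ Z₂ X₀ σ₀ → tot σ (Sum.inr v) = Sum.inr none) ∧
  (∀ v, Sum.inr v ∈ X → v ∉ Z₂ X₀ σ₀ → ∃ z, tot σ (Sum.inr v) = Sum.inr (some z))

variable (b₃ k)

/-- THE `2`-ADIC WEIGHT of a section over `X`: the conditioned local distribution of the `𝔽₃`-system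
(base domain `D X₀ = W₁`, base values `h₂`) at its honest part, for sections of the right shape.
[cite: LichterPago2025, Cor. 4.13 and proof of Thm 5.9 (p-solutions with a fixed local section)] -/
noncomputable def wt₃ (X : Finset (V ⊕ V)) (σ : ↥X → OrLinTemplate) : ℚ :=
  open scoped Classical in
  if X.card ≤ k ∧ Shape₃ S b₂ G r X₀ σ₀ X σ then
    LinSystem.locMeasure S b₃ r (E X₀ σ₀ X₀) (h₂ X₀ σ₀) (E X₀ σ₀ X) (hon₃ X₀ σ₀ X σ) else 0

variable {b₃ k}

/-- The section of shape `Shape₃` over `X` with prescribed honest sort-2 part `t`. [folklore] -/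
noncomputable def embE (X : Finset (V ⊕ V)) (t : ↥(E X₀ σ₀ X) → ZMod 3) : ↥X → OrLinTemplate :=
  fun x => match x with
    | ⟨Sum.inr v, hx⟩ =>
        if hv : v ∈ Z₂ X₀ σ₀ then Sum.inr none
        else Sum.inr (some (t ⟨v, Finset.mem_sdiff.2 ⟨Finset.mem_toRight.2 hx, hv⟩⟩))
    | ⟨Sum.inl w, _⟩ => Sum.inl (g₁ S b₂ G r X₀ σ₀ w)

variable {S b₂ G r X₀ σ₀}
variable {d : ℕ}

/-- Membership in the forced-honest set `N₁`. [folklore] -/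
theorem mem_N₁ {v : V} : v ∈ N₁ G X₀ σ₀ ↔ (∃ w ∈ Z₂ X₀ σ₀, G v w) ∧ Sum.inl v ∉ X₀ := by
  unfold N₁
  rw [Finset.mem_sdiff, Finset.mem_toLeft, Finset.mem_filter]
  simp only [Finset.mem_univ, true_and]

/-- Size of the forced-honest set: `|N₁| ≤ d |Z₂|` for in-degrees `≤ d`. [folklore] -/
theorem card_N₁_le (hdeg' : ∀ w : V, (Finset.univ.filter fun v => G v w).card ≤ d) :
    (N₁ G X₀ σ₀).card ≤ d * (Z₂ X₀ σ₀).card := by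
  unfold N₁
  calc ((Finset.univ.filter fun v => ∃ w ∈ Z₂ X₀ σ₀, G v w) \ X₀.toLeft).card
      ≤ (Finset.univ.filter fun v => ∃ w ∈ Z₂ X₀ σ₀, G v w).card :=
        Finset.card_le_card Finset.sdiff_subset
    _ ≤ ((Z₂ X₀ σ₀).biUnion fun w => Finset.univ.filter fun v => G v w).card := by
        refine Finset.card_le_card fun v hv => ?_
        rw [Finset.mem_filter] at hv
        obtain ⟨w, hw, hvw⟩ := hv.2
        exact Finset.mem_biUnion.2 ⟨w, hw, Finset.mem_filter.2 ⟨Finset.mem_univ _, hvw⟩⟩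
    _ ≤ ∑ w ∈ Z₂ X₀ σ₀, (Finset.univ.filter fun v => G v w).card := Finset.card_biUnion_le
    _ ≤ ∑ _w ∈ Z₂ X₀ σ₀, d := Finset.sum_le_sum fun w _ => hdeg' w
    _ = d * (Z₂ X₀ σ₀).card := by rw [Finset.sum_const, smul_eq_mul, mul_comm]

/-- The defining property of `gh₁` (under the hypotheses that make the extension exist): good on
`E0 ∪ N₁`, equal to `h₁` on `E0`. [folklore] -/
theorem gh₁_spec (hexp : ∀ T : Finset U, T.card ≤ r → 1 * T.card ≤ 2 * (XorSystem.boundary S T).card)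
    (hdeg' : ∀ w : V, (Finset.univ.filter fun v => G v w).card ≤ d) (hkr : 4 * (d + 2) * k ≤ r)
    (hσ₀ : σ₀ ∈ fam S b₂ b₃ G r k X₀) :
    LinSystem.Good S b₂ r (D X₀ σ₀ X₀ ∪ N₁ G X₀ σ₀) (gh₁ S b₂ G r X₀ σ₀) ∧
      ∀ w ∈ D X₀ σ₀ X₀, gh₁ S b₂ G r X₀ σ₀ w = h₁ X₀ σ₀ w := by
  classical
  have hk : X₀.card ≤ k := hσ₀.1
  have h1 : (D X₀ σ₀ X₀).card ≤ k := (card_D_le X₀).trans hk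
  have h2 : (N₁ G X₀ σ₀).card ≤ d * k :=
    (card_N₁_le hdeg').trans (Nat.mul_le_mul_left d (card_Z₂_le.trans hk))
  have h3 : (D X₀ σ₀ X₀ ∪ N₁ G X₀ σ₀).card ≤ k + d * k :=
    (Finset.card_union_le _ _).trans (Nat.add_le_add h1 h2)
  have hex : ∃ g : V → ZMod 2, LinSystem.Good S b₂ r (D X₀ σ₀ X₀ ∪ N₁ G X₀ σ₀) g ∧
      ∀ w ∈ D X₀ σ₀ X₀, g w = h₁ X₀ σ₀ w := by
    refine (good_h₁ hσ₀).extend Nat.one_pos hexp Finset.subset_union_left ?_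
    nlinarith [hkr, h3]
  unfold gh₁
  rw [dif_pos hex]
  exact hex.choose_spec

/-- Where the frozen sort-1 assignment escapes. [folklore] -/
theorem g₁_eq_none_iff {w : V} :
    g₁ S b₂ G r X₀ σ₀ w = none ↔ w ∈ Z₁ X₀ σ₀ ∨ w ∉ D X₀ σ₀ X₀ ∪ N₁ G X₀ σ₀ := by
  unfold g₁
  by_cases h1 : w ∈ Z₁ X₀ σ₀
  · simp [h1]
  · by_cases h2 : w ∈ D X₀ σ₀ X₀ ∪ N₁ G X₀ σ₀ <;> simp [h1, h2]

/-- Where the frozen sort-1 assignment is honest, its value is `gh₁`. [folklore] -/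
theorem g₁_eq_some {w : V} (h1 : w ∉ Z₁ X₀ σ₀) (h2 : w ∈ D X₀ σ₀ X₀ ∪ N₁ G X₀ σ₀) :
    g₁ S b₂ G r X₀ σ₀ w = some (gh₁ S b₂ G r X₀ σ₀ w) := by
  unfold g₁
  rw [if_neg h1, if_pos h2]

/-- The honest values of the frozen sort-1 assignment. [folklore] -/
theorem g₁_eq_some_iff {w : V} {z : ZMod 2} :
    g₁ S b₂ G r X₀ σ₀ w = some z ↔
      w ∉ Z₁ X₀ σ₀ ∧ w ∈ D X₀ σ₀ X₀ ∪ N₁ G X₀ σ₀ ∧ gh₁ S b₂ G r X₀ σ₀ w = z := by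
  unfold g₁
  by_cases h1 : w ∈ Z₁ X₀ σ₀
  · simp [h1]
  · by_cases h2 : w ∈ D X₀ σ₀ X₀ ∪ N₁ G X₀ σ₀ <;> simp [h1, h2]

/-- `g₁` agrees with the base section on its context. [folklore] -/
theorem g₁_base (hexp : ∀ T : Finset U, T.card ≤ r → 1 * T.card ≤ 2 * (XorSystem.boundary S T).card)
    (hdeg' : ∀ w : V, (Finset.univ.filter fun v => G v w).card ≤ d) (hkr : 4 * (d + 2) * k ≤ r)
    (hσ₀ : σ₀ ∈ fam S b₂ b₃ G r k X₀) {w : V} (hw : Sum.inl w ∈ X₀) :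
    Sum.inl (g₁ S b₂ G r X₀ σ₀ w) = tot σ₀ (Sum.inl w) := by
  by_cases hZ : w ∈ Z₁ X₀ σ₀
  · rw [(g₁_eq_none_iff).2 (Or.inl hZ), (mem_Z₁.1 hZ).2]
  · have hW : w ∈ D X₀ σ₀ X₀ := mem_D.2 ⟨hw, hZ⟩
    rw [g₁_eq_some hZ (Finset.mem_union_left _ hW), (gh₁_spec hexp hdeg' hkr hσ₀).2 w hW]
    obtain ⟨o, ho⟩ := hσ₀.2.1 w hw
    cases o with
    | none => exact absurd (mem_Z₁.2 ⟨hw, ho⟩) hZ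
    | some z => rw [ho]; unfold h₁; rw [ho]; rfl

/-- The base section has the shape. [folklore] -/
theorem shape₃_base (hexp : ∀ T : Finset U, T.card ≤ r → 1 * T.card ≤ 2 * (XorSystem.boundary S T).card)
    (hdeg' : ∀ w : V, (Finset.univ.filter fun v => G v w).card ≤ d) (hkr : 4 * (d + 2) * k ≤ r)
    (hσ₀ : σ₀ ∈ fam S b₂ b₃ G r k X₀) : Shape₃ S b₂ G r X₀ σ₀ X₀ σ₀ := by
  refine ⟨fun w hw => (g₁_base hexp hdeg' hkr hσ₀ hw).symm, fun v _ hv => (mem_Z₂.1 hv).2,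
    fun v hv hvZ => ?_⟩
  obtain ⟨o, ho⟩ := hσ₀.2.2.1 v hv
  cases o with
  | none => exact absurd (mem_Z₂.2 ⟨hv, ho⟩) hvZ
  | some z => exact ⟨z, ho⟩

/-! #### The embEedding `embE` and the honest part `hon₃` -/

/-- Sort-2 values of the embedded section: `c₂` on the base escapes, the prescribed honest values elsewhere. [folklore] -/
theorem tot_embE_inr {X : Finset (V ⊕ V)} (t : ↥(E X₀ σ₀ X) → ZMod 3) {v : V} (hv : Sum.inr v ∈ X) :
    tot (embE S b₂ G r X₀ σ₀ X t) (Sum.inr v) =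
      if hZ : v ∈ Z₂ X₀ σ₀ then Sum.inr none
      else Sum.inr (some (t ⟨v, mem_E.2 ⟨hv, hZ⟩⟩)) := by
  rw [tot_of_mem _ hv]
  unfold embE
  simp only
  split_ifs <;> rfl

/-- Sort-1 values of the embedded section follow the frozen assignment `g₁`. [folklore] -/
theorem tot_embE_inl {X : Finset (V ⊕ V)} (t : ↥(E X₀ σ₀ X) → ZMod 3) {w : V} (hw : Sum.inl w ∈ X) :
    tot (embE S b₂ G r X₀ σ₀ X t) (Sum.inl w) = Sum.inl (g₁ S b₂ G r X₀ σ₀ w) := by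
  rw [tot_of_mem _ hw]
  rfl

/-- Embedded sections have the shape (mirror image). [folklore] -/
theorem shape_embE {X : Finset (V ⊕ V)} (t : ↥(E X₀ σ₀ X) → ZMod 3) :
    Shape₃ S b₂ G r X₀ σ₀ X (embE S b₂ G r X₀ σ₀ X t) := by
  refine ⟨fun w hw => tot_embE_inl t hw, fun v hv hZ => ?_, fun v hv hZ => ?_⟩
  · rw [tot_embE_inr t hv, dif_pos hZ]
  · exact ⟨_, by rw [tot_embE_inr t hv, dif_neg hZ]⟩

/-- The honest part of the embedded section is the prescribed one (mirror image). [folklore] -/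
theorem hon₃_embE {X : Finset (V ⊕ V)} (t : ↥(E X₀ σ₀ X) → ZMod 3) :
    hon₃ X₀ σ₀ X (embE S b₂ G r X₀ σ₀ X t) = t := by
  funext d
  have hd := mem_E.1 d.2
  unfold hon₃
  rw [tot_embE_inr t hd.1, dif_neg hd.2]
  rfl

/-- A section of the right shape is the embedding of its honest part (mirror image). [folklore] -/
theorem embE_hon₃ {X : Finset (V ⊕ V)} {σ : ↥X → OrLinTemplate} (hσ : Shape₃ S b₂ G r X₀ σ₀ X σ) :
    embE S b₂ G r X₀ σ₀ X (hon₃ X₀ σ₀ X σ) = σ := by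
  refine eq_of_tot_eq fun x hx => ?_
  obtain ⟨hr₂, hz, hh⟩ := hσ
  cases x with
  | inl w => rw [tot_embE_inl _ hx, hr₂ w hx]
  | inr v =>
    rw [tot_embE_inr _ hx]
    by_cases hZ : v ∈ Z₂ X₀ σ₀
    · rw [dif_pos hZ, hz v hx hZ]
    · rw [dif_neg hZ]
      obtain ⟨z, hzv⟩ := hh v hx hZ
      rw [hzv]
      unfold hon₃
      simp only [hzv, hv₂_inr_some]

/-- The embedding of honest parts is injective (mirror image). [folklore] -/
theorem embE_injective (X : Finset (V ⊕ V)) : Function.Injective (embE S b₂ G r X₀ σ₀ X) :=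
  fun t₁ t₂ h => by rw [← hon₃_embE (S := S) (b₂ := b₂) (G := G) (r := r) t₁, h, hon₃_embE]

/-- The shape is preserved under restriction of contexts (mirror image). [folklore] -/
theorem shape₃_restrict {X' X : Finset (V ⊕ V)} (hX : X' ⊆ X) {σ : ↥X → OrLinTemplate}
    (hσ : Shape₃ S b₂ G r X₀ σ₀ X σ) : Shape₃ S b₂ G r X₀ σ₀ X' (SectionSystem.restrict hX σ) := by
  obtain ⟨hr₂, hz, hh⟩ := hσ
  refine ⟨fun w hw => ?_, fun v hv hZ => ?_, fun v hv hZ => ?_⟩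
  · rw [tot_restrict hX σ hw, hr₂ w (hX hw)]
  · rw [tot_restrict hX σ hv, hz v (hX hv) hZ]
  · rw [tot_restrict hX σ hv]; exact hh v (hX hv) hZ

/-- Restriction of an embedded section is the embedding of the restricted honest part (mirror image). [folklore] -/
theorem restrict_embE {X' X : Finset (V ⊕ V)} (hX : X' ⊆ X) (t : ↥(E X₀ σ₀ X) → ZMod 3) :
    SectionSystem.restrict hX (embE S b₂ G r X₀ σ₀ X t) =
      embE S b₂ G r X₀ σ₀ X' (Finset.restrict₂ (π := fun _ => ZMod 3) (E_mono hX) t) := by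
  rw [← embE_hon₃ (shape₃_restrict hX (shape_embE t)), hon₃_restrict, hon₃_embE]

open scoped Classical in
/-- The sections of the right shape over `X` are exactly the embEedded honest sections. [folklore] -/
theorem filter_shape₃_eq_image (X : Finset (V ⊕ V)) :
    (Finset.univ.filter fun σ => Shape₃ S b₂ G r X₀ σ₀ X σ) =
      Finset.univ.image (embE S b₂ G r X₀ σ₀ X) := by
  ext σ
  rw [Finset.mem_filter, Finset.mem_image]
  constructor
  · rintro ⟨-, h⟩
    exact ⟨_, Finset.mem_univ _, embE_hon₃ h⟩
  · rintro ⟨t, -, ht⟩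
    exact ⟨Finset.mem_univ _, ht ▸ shape_embE t⟩

/-! #### Support: sections of non-zero weight are in the family -/

/-- **Support of the `3`-adic family.** A section of non-zero weight belongs to `𝓕`.
[cite: LichterPago2025, proof of Thm 5.9 (the p-solutions are supported on H)] -/
theorem mem_fam_of_wt₃_ne_zero (hr : 1 ≤ r)
    (hexp : ∀ T : Finset U, T.card ≤ r → 1 * T.card ≤ 2 * (XorSystem.boundary S T).card)
    (hdeg' : ∀ w : V, (Finset.univ.filter fun v => G v w).card ≤ d) (hkr : 4 * (d + 2) * k ≤ r)
    (hσ₀ : σ₀ ∈ fam S b₂ b₃ G r k X₀) {X : Finset (V ⊕ V)} {σ : ↥X → OrLinTemplate}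
    (hw : wt₃ S b₂ b₃ G r k X₀ σ₀ X σ ≠ 0) : σ ∈ fam S b₂ b₃ G r k X := by
  classical
  unfold wt₃ at hw
  split_ifs at hw with hcond
  swap; · exact absurd rfl hw
  obtain ⟨hXk, hshape⟩ := hcond
  obtain ⟨hr₂, hz, hh⟩ := hshape
  obtain ⟨x, hxgood, -, hxt⟩ := LinSystem.exists_of_locMeasure_ne_zero hw
  obtain ⟨hgood₂, -⟩ := gh₁_spec hexp hdeg' hkr hσ₀
  -- honest sort-2 values are those of `x` on `D X`
  have hxv : ∀ v (hv : v ∈ E X₀ σ₀ X), x v = hv₂ (tot σ (Sum.inr v)) := fun v hv => hxt ⟨v, hv⟩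
  refine ⟨hXk, fun w hw => ⟨_, hr₂ w hw⟩, fun v hv => ?_, fun u hu => ?_, fun u hu => ?_,
    fun v w hvw hv hw hesc => ?_, ?_, ?_⟩
  · by_cases hZ : v ∈ Z₂ X₀ σ₀
    · exact ⟨none, hz v hv hZ⟩
    · obtain ⟨z, hzv⟩ := hh v hv hZ
      exact ⟨some z, hzv⟩
  · -- an `𝔽₂`-equation inside the context (frozen sort)
    by_cases hesc : ∃ w ∈ S u, g₁ S b₂ G r X₀ σ₀ w = none
    · obtain ⟨w, hw, hwn⟩ := hesc
      exact Or.inl ⟨w, hw, by rw [hr₂ w (hu w hw), hwn]⟩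
    · right
      have hsome : ∀ w ∈ S u, g₁ S b₂ G r X₀ σ₀ w = some (gh₁ S b₂ G r X₀ σ₀ w) := by
        intro w hw
        cases hgw : g₁ S b₂ G r X₀ σ₀ w with
        | none => exact absurd ⟨w, hw, hgw⟩ hesc
        | some z => rw [((g₁_eq_some_iff).1 hgw).2.2]
      have hWN : ∀ w ∈ S u, w ∈ D X₀ σ₀ X₀ ∪ N₁ G X₀ σ₀ := fun w hw =>
        ((g₁_eq_some_iff).1 (hsome w hw)).2.1
      refine ⟨fun w hw => ⟨_, by rw [hr₂ w (hu w hw), hsome w hw]⟩, ?_⟩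
      have : ∀ w ∈ S u, hv₁ (tot σ (Sum.inl w)) = gh₁ S b₂ G r X₀ σ₀ w := fun w hw => by
        rw [hr₂ w (hu w hw), hsome w hw]; rfl
      rw [Finset.sum_congr rfl this]
      exact hgood₂.sum_eq hr fun w hw => hWN w hw
  · -- an `𝔽₃`-equation inside the context (distributed sort)
    by_cases hesc : ∃ v ∈ S u, v ∈ Z₂ X₀ σ₀
    · obtain ⟨v, hv, hvZ⟩ := hesc
      exact Or.inl ⟨v, hv, hz v (hu v hv) hvZ⟩
    · right
      have hD : ∀ v ∈ S u, v ∈ E X₀ σ₀ X := fun v hv =>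
        mem_E.2 ⟨hu v hv, fun hvZ => hesc ⟨v, hv, hvZ⟩⟩
      refine ⟨fun v hv => hh v (hu v hv) (mem_E.1 (hD v hv)).2, ?_⟩
      rw [← Finset.sum_congr rfl fun v hv => hxv v (hD v hv)]
      exact (hxgood.mono Finset.subset_union_right).sum_eq hr fun v hv => hD v hv
  · -- no `G`-edge carries `(c₁, c₂)`
    intro hnone
    have hwZ : w ∈ Z₂ X₀ σ₀ := by
      by_contra hwZ
      obtain ⟨z, hzw⟩ := hh w hw hwZ
      rw [hzw] at hnone
      cases hnone
    obtain ⟨hw₀, hw₀t⟩ := mem_Z₂.1 hwZ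
    have hg : g₁ S b₂ G r X₀ σ₀ v = none := Sum.inl_injective ((hr₂ v hv).symm.trans hesc)
    have hcase : v ∉ Z₁ X₀ σ₀ := fun hvZ =>
      hσ₀.2.2.2.2.2.1 v w hvw (mem_Z₁.1 hvZ).1 hw₀ (mem_Z₁.1 hvZ).2 hw₀t
    rcases (g₁_eq_none_iff).1 hg with hvZ | hvWN
    · exact hcase hvZ
    · apply hvWN
      by_cases hv₀ : Sum.inl v ∈ X₀
      · exact Finset.mem_union_left _ (mem_D.2 ⟨hv₀, hcase⟩)
      · exact Finset.mem_union_right _ (mem_N₁.2 ⟨⟨w, hwZ, hvw⟩, hv₀⟩)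
  · -- goodness of the honest sort-1 part
    have hsub : (X.toLeft.filter fun w => ∃ z, tot σ (Sum.inl w) = Sum.inl (some z)) ⊆
        D X₀ σ₀ X₀ ∪ N₁ G X₀ σ₀ := by
      intro w hw
      rw [Finset.mem_filter, Finset.mem_toLeft] at hw
      obtain ⟨hw, z, hzw⟩ := hw
      rw [hr₂ w hw] at hzw
      exact ((g₁_eq_some_iff).1 (Sum.inl_injective hzw)).2.1
    refine (hgood₂.mono hsub).congr fun w hw => ?_
    rw [Finset.mem_filter, Finset.mem_toLeft] at hw
    obtain ⟨hw, z, hzw⟩ := hw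
    have hg : g₁ S b₂ G r X₀ σ₀ w = some z := Sum.inl_injective ((hr₂ w hw).symm.trans hzw)
    show gh₁ S b₂ G r X₀ σ₀ w = hv₁ (tot σ (Sum.inl w))
    rw [hzw, hv₁_inl_some]
    exact ((g₁_eq_some_iff).1 hg).2.2
  · -- goodness of the honest sort-2 part
    have hset : (X.toRight.filter fun v => ∃ z, tot σ (Sum.inr v) = Sum.inr (some z)) = E X₀ σ₀ X := by
      ext v
      rw [Finset.mem_filter, Finset.mem_toRight, mem_E]
      constructor
      · rintro ⟨hv, z, hzv⟩
        refine ⟨hv, fun hZ => ?_⟩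
        rw [hz v hv hZ] at hzv
        cases hzv
      · rintro ⟨hv, hZ⟩
        exact ⟨hv, hh v hv hZ⟩
    rw [hset]
    exact (hxgood.mono Finset.subset_union_right).congr fun v hv => hxv v hv

/-! #### Compatibility and base -/

/-- **Compatibility of the `3`-adic family** under restriction of contexts.
[cite: LichterPago2025, Lemma 4.7 and Lemma 3.7 (solutions of the width-k system transfer)] -/
theorem sum_wt₃_restrict
    (hexp : ∀ T : Finset U, T.card ≤ r → 1 * T.card ≤ 2 * (XorSystem.boundary S T).card)
    (hkr : 4 * (d + 2) * k ≤ r) (hσ₀ : σ₀ ∈ fam S b₂ b₃ G r k X₀)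
    {X' X : Finset (V ⊕ V)} (hX : X' ⊆ X) (hXk : X.card ≤ k) (τ : ↥X' → OrLinTemplate) :
    ∑ σ : ↥X → OrLinTemplate,
        (if SectionSystem.restrict hX σ = τ then wt₃ S b₂ b₃ G r k X₀ σ₀ X σ else 0) =
      wt₃ S b₂ b₃ G r k X₀ σ₀ X' τ := by
  classical
  have hX'k : X'.card ≤ k := (Finset.card_le_card hX).trans hXk
  have hWD : 2 * 2 * (E X₀ σ₀ X₀ ∪ E X₀ σ₀ X).card ≤ 1 * r := by
    have h1 : (E X₀ σ₀ X₀ ∪ E X₀ σ₀ X).card ≤ k + k :=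
      (Finset.card_union_le _ _).trans (Nat.add_le_add ((card_E_le X₀).trans hσ₀.1)
        ((card_E_le X).trans hXk))
    nlinarith [hkr, h1]
  by_cases hτ : Shape₃ S b₂ G r X₀ σ₀ X' τ
  · -- restrict the sum to sections of the right shape, reindex by honest parts
    have hzero : ∀ σ : ↥X → OrLinTemplate, ¬ Shape₃ S b₂ G r X₀ σ₀ X σ →
        (if SectionSystem.restrict hX σ = τ then wt₃ S b₂ b₃ G r k X₀ σ₀ X σ else 0) = 0 := by
      intro σ hσ
      rw [ite_eq_right_iff]
      intro _
      unfold wt₃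
      rw [if_neg (fun h => hσ h.2)]
    rw [← Finset.sum_subset (Finset.subset_univ (Finset.univ.filter fun σ => Shape₃ S b₂ G r X₀ σ₀ X σ))
      (fun σ _ hσ => hzero σ (fun h => hσ (Finset.mem_filter.2 ⟨Finset.mem_univ _, h⟩))),
      filter_shape₃_eq_image, Finset.sum_image fun t₁ _ t₂ _ h => embE_injective X h]
    have hterm : ∀ t : ↥(E X₀ σ₀ X) → ZMod 3,
        (if SectionSystem.restrict hX (embE S b₂ G r X₀ σ₀ X t) = τ then
            wt₃ S b₂ b₃ G r k X₀ σ₀ X (embE S b₂ G r X₀ σ₀ X t) else 0) =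
          if Finset.restrict₂ (π := fun _ => ZMod 3) (E_mono hX) t = hon₃ X₀ σ₀ X' τ then
            LinSystem.locMeasure S b₃ r (E X₀ σ₀ X₀) (h₂ X₀ σ₀) (E X₀ σ₀ X) t else 0 := by
      intro t
      have hiff : SectionSystem.restrict hX (embE S b₂ G r X₀ σ₀ X t) = τ ↔
          Finset.restrict₂ (π := fun _ => ZMod 3) (E_mono hX) t = hon₃ X₀ σ₀ X' τ := by
        rw [restrict_embE]
        constructor
        · intro h; rw [← h, hon₃_embE]
        · intro h; rw [h, embE_hon₃ hτ]
      by_cases h : Finset.restrict₂ (π := fun _ => ZMod 3) (E_mono hX) t = hon₃ X₀ σ₀ X' τ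
      · rw [if_pos (hiff.2 h), if_pos h]
        unfold wt₃
        rw [if_pos ⟨hXk, shape_embE t⟩, hon₃_embE]
      · rw [if_neg (fun h' => h (hiff.1 h')), if_neg h]
    rw [Finset.sum_congr rfl fun t _ => hterm t,
      LinSystem.sum_locMeasure_restrict Nat.one_pos hexp (E_mono hX) hWD]
    unfold wt₃
    rw [if_pos ⟨hX'k, hτ⟩]
  · -- wrong shape: both sides vanish
    have hrhs : wt₃ S b₂ b₃ G r k X₀ σ₀ X' τ = 0 := by
      unfold wt₃; rw [if_neg (fun h => hτ h.2)]
    rw [hrhs]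
    refine Finset.sum_eq_zero fun σ _ => ?_
    rw [ite_eq_right_iff]
    rintro rfl
    by_contra hne
    unfold wt₃ at hne
    split_ifs at hne with hcond
    · exact hτ (shape₃_restrict hX hcond.2)
    · exact hne rfl

/-- **Base of the `3`-adic family**: over the base context the weight is the indicator of `σ₀`.
[cite: LichterPago2025, Cor. 4.13 (the p-solution sets x_{Z,f} = 1)] -/
theorem wt₃_base (hexp : ∀ T : Finset U, T.card ≤ r → 1 * T.card ≤ 2 * (XorSystem.boundary S T).card)
    (hdeg' : ∀ w : V, (Finset.univ.filter fun v => G v w).card ≤ d) (hkr : 4 * (d + 2) * k ≤ r)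
    (hσ₀ : σ₀ ∈ fam S b₂ b₃ G r k X₀) (τ : ↥X₀ → OrLinTemplate) :
    wt₃ S b₂ b₃ G r k X₀ σ₀ X₀ τ = if τ = σ₀ then 1 else 0 := by
  classical
  have hW : 2 * 2 * (E X₀ σ₀ X₀).card ≤ 1 * r := by
    have := (card_E_le (X₀ := X₀) (σ₀ := σ₀) X₀).trans hσ₀.1
    nlinarith [hkr]
  have hbase : hon₃ X₀ σ₀ X₀ σ₀ = (E X₀ σ₀ X₀).restrict (h₂ X₀ σ₀) := rfl
  have hsh := shape₃_base hexp hdeg' hkr hσ₀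
  unfold wt₃
  by_cases hτσ : τ = σ₀
  · subst hτσ
    rw [if_pos ⟨hσ₀.1, hsh⟩, if_pos rfl,
      LinSystem.locMeasure_self Nat.one_pos hexp hW (good_h₂_E hσ₀), if_pos hbase]
  · rw [if_neg hτσ]
    split_ifs with hcond
    · rw [LinSystem.locMeasure_self Nat.one_pos hexp hW (good_h₂_E hσ₀), if_neg]
      intro heq
      apply hτσ
      calc τ = embE S b₂ G r X₀ σ₀ X₀ (hon₃ X₀ σ₀ X₀ τ) := (embE_hon₃ hcond.2).symm
        _ = embE S b₂ G r X₀ σ₀ X₀ (hon₃ X₀ σ₀ X₀ σ₀) := by rw [heq, ← hbase]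
        _ = σ₀ := embE_hon₃ hsh
    · rfl

/-- **Integrality after scaling by `2^k`.** [cite: LichterPago2025, Lemma 2.2] -/
theorem exists_int_three_pow_mul_wt₃ (X : Finset (V ⊕ V)) (σ : ↥X → OrLinTemplate) :
    ∃ z : ℤ, ((3 ^ k : ℕ) : ℚ) * wt₃ S b₂ b₃ G r k X₀ σ₀ X σ = z := by
  classical
  unfold wt₃
  split_ifs with hcond
  · haveI : Fact (Nat.Prime 3) := ⟨Nat.prime_three⟩
    obtain ⟨n, hn⟩ := LinSystem.exists_nat_eq_pow_mul_locMeasure (S := S) (b := b₃) (r := r)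
      (W := E X₀ σ₀ X₀) (h := h₂ X₀ σ₀) (D := E X₀ σ₀ X) (hon₃ X₀ σ₀ X σ)
    have hle : (E X₀ σ₀ X).card ≤ k := (card_E_le X).trans hcond.1
    have hn' : (n : ℚ) = 3 ^ (E X₀ σ₀ X).card *
        LinSystem.locMeasure S b₃ r (E X₀ σ₀ X₀) (h₂ X₀ σ₀) (E X₀ σ₀ X) (hon₃ X₀ σ₀ X σ) := by
      simpa using hn
    refine ⟨((3 ^ (k - (E X₀ σ₀ X).card) * n : ℕ) : ℤ), ?_⟩
    push_cast
    rw [hn', ← mul_assoc, ← pow_add, Nat.sub_add_cancel hle]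
  · exact ⟨0, by simp⟩

/-- **The `3`-adic family is a rational linear section of `𝓕` based at `σ₀`.**
[cite: LichterPago2025, proof of Thm 5.9 (stability of H under the cohomological algorithm, p-solution part)] -/
theorem isRatSection_wt₃ (hr : 1 ≤ r)
    (hexp : ∀ T : Finset U, T.card ≤ r → 1 * T.card ≤ 2 * (XorSystem.boundary S T).card)
    (hdeg' : ∀ w : V, (Finset.univ.filter fun v => G v w).card ≤ d) (hkr : 4 * (d + 2) * k ≤ r)
    (hσ₀ : σ₀ ∈ fam S b₂ b₃ G r k X₀) :
    SectionSystem.IsRatSection k (fam S b₂ b₃ G r k) X₀ σ₀ (wt₃ S b₂ b₃ G r k X₀ σ₀) :=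
  ⟨fun _ _ hw => mem_fam_of_wt₃_ne_zero hr hexp hdeg' hkr hσ₀ hw,
    fun _ _ hX hXk τ => sum_wt₃_restrict hexp hkr hσ₀ hX hXk τ,
    fun τ => wt₃_base hexp hdeg' hkr hσ₀ τ⟩

end ThreeAdic

/-! ### Cohomological `k`-consistency of the sparse OR-instance -/

section Main

variable [Fintype V] [DecidableRel G]

/-- **The sparse OR-instance of two expanding ternary systems is cohomologically `k`-consistent**
w.r.t. `OR_⊥(𝔽₂-equations, 𝔽₃-equations)`, for every `k` with `4(d+2)k ≤ r`: hypotheses are three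
variables per equation, boundary expansion `|T| ≤ 2|∂T|` for all `|T| ≤ r` (`r ≥ 1`), and in- and
out-degrees of the link graph `G` at most `d`.  (Observation 22 form: the family `𝓕` is non-empty,
lies in `𝓗_k`, and every member is `ℤ`-extendable in `𝓕` by the Bezout combination of the `2`-adic and
the `3`-adic rational linear sections above it.)  This is the consistency half of the repaired proof of
Lichter–Pago's Theorem 5.9; NO unsatisfiability hypothesis is needed for it.
[cite: LichterPago2025, Thm 5.9 (claimed for the complete link relation; proof repaired here); OConghaile2022, Observation 22] -/
theorem cohomologicallyKConsistent {d : ℕ} (hS3 : ∀ u, (S u).card = 3) (hr : 1 ≤ r)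
    (hexp : ∀ T : Finset U, T.card ≤ r → T.card ≤ 2 * (XorSystem.boundary S T).card)
    (hdeg : ∀ v : V, (Finset.univ.filter fun w => G v w).card ≤ d)
    (hdeg' : ∀ w : V, (Finset.univ.filter fun v => G v w).card ≤ d) (hkr : 4 * (d + 2) * k ≤ r) :
    @CohomologicallyKConsistent orLinLanguage k (V ⊕ V) OrLinTemplate (sparseOrStructure S b₂ b₃ G)
      _ _ := by
  have hexp1 : ∀ T : Finset U, T.card ≤ r → 1 * T.card ≤ 2 * (XorSystem.boundary S T).card :=
    fun T hT => by rw [one_mul]; exact hexp T hT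
  refine (@cohomologicallyKConsistent_iff_zext orLinLanguage k (V ⊕ V) OrLinTemplate
    (sparseOrStructure S b₂ b₃ G) _ _).2 ⟨fam S b₂ b₃ G r k, fam_le_homSystem hS3,
    ⟨∅, fun _ => Sum.inl none, empty_mem_fam hS3 hexp1 _⟩, fun X₀ σ₀ hσ₀ => ?_⟩
  exact SectionSystem.ZExt.of_isRatSection_coprime (isRatSection_wt hr hexp1 hdeg hkr hσ₀)
    (isRatSection_wt₃ hr hexp1 hdeg' hkr hσ₀) (Nat.Coprime.pow k k (by decide))
    (exists_int_two_pow_mul_wt) (exists_int_three_pow_mul_wt₃)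

end Main


/-! ### Unsatisfiability of the sparse OR-instance

If both systems are ROBUSTLY UNSATISFIABLE (every assignment violates an equation avoiding any
prescribed set of at most `z₀` variables) and the link graph is MIXING (any two sets of more than `z₀`
variables are joined by an edge), then the sparse OR-instance has no homomorphism to `OR_⊥`: the
non-honest variables of each sort form sets `Z₁, Z₂` of more than `z₀` elements, and an edge between
them carries the forbidden pair `(c₁, c₂)` (or leaves a sort). -/

section Unsat

/-- An injective enumeration of a three-element scope. [folklore] -/
theorem exists_enum_of_card_eq_three {T : Finset V} (hT : T.card = 3) :
    ∃ y : Fin 3 → V, Function.Injective y ∧ ∀ i, y i ∈ T := by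
  obtain ⟨a, b, c, hab, hac, hbc, rfl⟩ := Finset.card_eq_three.1 hT
  refine ⟨![a, b, c], fun i j h => ?_, fun i => ?_⟩
  · fin_cases i <;> fin_cases j <;> simp_all
  · fin_cases i <;> simp

omit [Fintype U] [DecidableEq U] in
/-- **Unsatisfiability of the sparse OR-instance** from robust unsatisfiability of the two systems
(threshold `z₀`) and the mixing property of the link graph above `z₀`.
[cite: LichterPago2025, Lemma 3.1 (the case of the complete link relation); this sparse variant: folklore] -/
theorem isEmpty_hom [Fintype V] (hS3 : ∀ u, (S u).card = 3) {z₀ : ℕ}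
    (hrob₂ : ∀ Z : Finset V, Z.card ≤ z₀ → ∀ x : V → ZMod 2,
      ∃ u, Disjoint (S u) Z ∧ ¬ LinSystem.Sat S b₂ x u)
    (hrob₃ : ∀ Z : Finset V, Z.card ≤ z₀ → ∀ x : V → ZMod 3,
      ∃ u, Disjoint (S u) Z ∧ ¬ LinSystem.Sat S b₃ x u)
    (hmix : ∀ Z Z' : Finset V, z₀ < Z.card → z₀ < Z'.card → ∃ v ∈ Z, ∃ w ∈ Z', G v w) :
    IsEmpty (@FirstOrder.Language.Hom orLinLanguage (V ⊕ V) OrLinTemplate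
      (sparseOrStructure S b₂ b₃ G) _) := by
  classical
  refine ⟨fun F => ?_⟩
  -- the non-honest variables of each sort
  set Z : Finset V := Finset.univ.filter fun v => ∀ z : ZMod 2, F (Sum.inl v) ≠ Sum.inl (some z)
    with hZ
  set Z' : Finset V := Finset.univ.filter fun w => ∀ z : ZMod 3, F (Sum.inr w) ≠ Sum.inr (some z)
    with hZ'
  -- sort 1: the honest values satisfy every equation avoiding `Z`, so `|Z| > z₀`
  have hZcard : z₀ < Z.card := by
    by_contra hle
    obtain ⟨u, hdisj, hnsat⟩ := hrob₂ Z (not_lt.1 hle) (fun v => hv₁ (F (Sum.inl v)))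
    obtain ⟨y, hyinj, hyS⟩ := exists_enum_of_card_eq_three (hS3 u)
    have hrel : @RelMap orLinLanguage (V ⊕ V) (sparseOrStructure S b₂ b₃ G) 3
        (OrRel.inl (LinRel.eq (b₂ u))) (fun i => Sum.inl (y i)) :=
      (relMap_inl S b₂ b₃ G _ _).2 ⟨y, fun _ => rfl, u, rfl, hyinj, hyS⟩
    have himg := @FirstOrder.Language.Hom.map_rel orLinLanguage (V ⊕ V) OrLinTemplate
      (sparseOrStructure S b₂ b₃ G) _ F 3 _ _ hrel
    obtain ⟨o, ho, hcases⟩ := (OrTemplate.relMap_inl (L₁ := linLanguage 2) (L₂ := linLanguage 3)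
      (A₁ := ZMod 2) (A₂ := ZMod 3) (show (linLanguage 2).Relations 3 from LinRel.eq (b₂ u)) _).1 himg
    -- every enumerated variable is honest
    have hhon : ∀ i, ∃ z, o i = some z := by
      intro i
      have hyZ : y i ∉ Z := Finset.disjoint_left.1 hdisj (hyS i)
      have hex : ∃ z : ZMod 2, F (Sum.inl (y i)) = Sum.inl (some z) := by
        by_contra h
        exact hyZ (Finset.mem_filter.2 ⟨Finset.mem_univ _, fun z hz => h ⟨z, hz⟩⟩)
      obtain ⟨z, hz⟩ := hex
      have h1 : F (Sum.inl (y i)) = Sum.inl (o i) := ho i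
      exact ⟨z, Sum.inl_injective (h1.symm.trans hz)⟩
    rcases hcases with hall | ⟨i, hi⟩ | ⟨z, hz, hsum⟩
    · obtain ⟨z, hz⟩ := hhon 0; rw [hall 0] at hz; cases hz
    · obtain ⟨z, hz⟩ := hhon i; rw [hi] at hz; cases hz
    · apply hnsat
      show ∑ v ∈ S u, hv₁ (F (Sum.inl v)) = b₂ u
      rw [sum_scope_eq_of_injective (hS3 u) hyinj hyS]
      have hval : ∀ i, hv₁ (F (Sum.inl (y i))) = z i := fun i => by
        have h1 : F (Sum.inl (y i)) = Sum.inl (o i) := ho i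
        rw [h1, hz i]; rfl
      rw [hval 0, hval 1, hval 2]
      exact hsum
  -- sort 2, symmetrically
  have hZ'card : z₀ < Z'.card := by
    by_contra hle
    obtain ⟨u, hdisj, hnsat⟩ := hrob₃ Z' (not_lt.1 hle) (fun w => hv₂ (F (Sum.inr w)))
    obtain ⟨y, hyinj, hyS⟩ := exists_enum_of_card_eq_three (hS3 u)
    have hrel : @RelMap orLinLanguage (V ⊕ V) (sparseOrStructure S b₂ b₃ G) 3
        (OrRel.inr (LinRel.eq (b₃ u))) (fun i => Sum.inr (y i)) :=
      (relMap_inr S b₂ b₃ G _ _).2 ⟨y, fun _ => rfl, u, rfl, hyinj, hyS⟩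
    have himg := @FirstOrder.Language.Hom.map_rel orLinLanguage (V ⊕ V) OrLinTemplate
      (sparseOrStructure S b₂ b₃ G) _ F 3 _ _ hrel
    obtain ⟨o, ho, hcases⟩ := (OrTemplate.relMap_inr (L₁ := linLanguage 2) (L₂ := linLanguage 3)
      (A₁ := ZMod 2) (A₂ := ZMod 3) (show (linLanguage 3).Relations 3 from LinRel.eq (b₃ u)) _).1 himg
    have hhon : ∀ i, ∃ z, o i = some z := by
      intro i
      have hyZ : y i ∉ Z' := Finset.disjoint_left.1 hdisj (hyS i)
      have hex : ∃ z : ZMod 3, F (Sum.inr (y i)) = Sum.inr (some z) := by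
        by_contra h
        exact hyZ (Finset.mem_filter.2 ⟨Finset.mem_univ _, fun z hz => h ⟨z, hz⟩⟩)
      obtain ⟨z, hz⟩ := hex
      have h1 : F (Sum.inr (y i)) = Sum.inr (o i) := ho i
      exact ⟨z, Sum.inr_injective (h1.symm.trans hz)⟩
    rcases hcases with hall | ⟨i, hi⟩ | ⟨z, hz, hsum⟩
    · obtain ⟨z, hz⟩ := hhon 0; rw [hall 0] at hz; cases hz
    · obtain ⟨z, hz⟩ := hhon i; rw [hi] at hz; cases hz
    · apply hnsat
      show ∑ w ∈ S u, hv₂ (F (Sum.inr w)) = b₃ u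
      rw [sum_scope_eq_of_injective (hS3 u) hyinj hyS]
      have hval : ∀ i, hv₂ (F (Sum.inr (y i))) = z i := fun i => by
        have h1 : F (Sum.inr (y i)) = Sum.inr (o i) := ho i
        rw [h1, hz i]; rfl
      rw [hval 0, hval 1, hval 2]
      exact hsum
  -- an edge between the two non-honest sets carries a forbidden pair
  obtain ⟨v, hv, w, hw, hvw⟩ := hmix Z Z' hZcard hZ'card
  have hrel : @RelMap orLinLanguage (V ⊕ V) (sparseOrStructure S b₂ b₃ G) 2 OrRel.link
      ![Sum.inl v, Sum.inr w] :=
    (relMap_link S b₂ b₃ G _).2 ⟨v, w, hvw, rfl, rfl⟩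
  have himg := @FirstOrder.Language.Hom.map_rel orLinLanguage (V ⊕ V) OrLinTemplate
    (sparseOrStructure S b₂ b₃ G) _ F 2 _ _ hrel
  have hv' : ∀ z : ZMod 2, F (Sum.inl v) ≠ Sum.inl (some z) := (Finset.mem_filter.1 hv).2
  have hw' : ∀ z : ZMod 3, F (Sum.inr w) ≠ Sum.inr (some z) := (Finset.mem_filter.1 hw).2
  rcases (OrTemplate.relMap_link (L₁ := linLanguage 2) (L₂ := linLanguage 3) _).1 himg with
    ⟨a, o, h0, -⟩ | ⟨o, a, -, h1⟩
  · exact hv' a h0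
  · exact hw' a h1

end Unsat

end SparseOr

end Literature.ModelTheory.FiniteModelTheory
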